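import Literature.NumberTheory.LFunctions.XiDerivativeZeroCountingFunction
import Literature.NumberTheory.LFunctions.XiHigherDerivativesCriticalZeros
import Literature.NumberTheory.LFunctions.FreitasLiHalfPlanesProofs
import Literature.NumberTheory.LFunctions.CriticalLineMontgomeryTaylorCumulative
import HarnessLib

/-!
# The zero-counting function of `ξ″`: `N^{(2)}(T) = N(T) + O(log T)` (Conrey 1983, Lemma 2, `m = 2`)

RH-FREE (every statement below is an unconditional theorem of this tree; nothing here bears on the
truth of RH). Topic `Literature/NumberTheory/LFunctions`, namespace `Literature.NumberTheory.LFunctions`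
(helpers in `XiDeriv2Arg`). PROOF LAYER for `XiDerivativeZeros.lean` (J. B. Conrey, *Zeros of derivatives
of Riemann's ξ-function on the critical line*, J. Number Theory **16** (1983) 49–74, key `Conrey1983`),
the case `m = 2` of the counting part of Lemma 2 (p. 52): "If `N^{(m)}(T)` denotes the number of zeros of
`ξ^{(m)}(s)` with `0 < t < T`, then `N^{(m)}(T) = (T/2π) log(T/2π) − T/2π + O_m(log T)` … proven by the
argument principle … similar to Backlund's proof of the assertion in the case `m = 0`". The tree has
`m = 1` (`XiDerivativeZeroCountingFunction.lean`); this file runs the SAME Backlund argument for `ξ″`: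

* the argument principle for `ξ″` on `[−1,2] × [−T,T]` folded by the symmetries
  `ξ‴/ξ″(1−s) = −ξ‴/ξ″(s)`, `ξ‴/ξ″(s̄) = conj` onto the quarter path (`quarter_path_eq_xiDeriv2`:
  `A₂ − B₂ = π N^{(2)}(T)`; all zeros of `ξ″` are in `0 < Re s < 1` — `Conrey1983_lemma2_strip 2` — and
  none is real — `ξ″ > 0` on `ℝ`, Freitas 2006 Thm 2.2, tree `Freitas2006_thm_2_2_holds`);
* the vertical edge: `ξ‴/ξ″ − ξ″/ξ′ = g₁′/g₁` with `g₁ = ξ″/ξ′`, `Re g₁ > 0` on `Re s = 2` (Conrey's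
  inequality for `m = 1`, tree `re_deriv2_div_deriv_riemannXi_pos_of_one_le_re`), so `|A₂ − A₁| ≤ π`,
  and `|A₁ − A| ≤ π` from the `m = 1` file;
* the horizontal edge: `ξ″/ξ = h₂/ζ` near the segment with `h₂ = h′ + G h` ANALYTIC on `Re s > 0`
  (`h = ζ′ + Gζ`, `G = 1/s + 1/(s−1) + Γℝ′/Γℝ`, the `m = 1` file's `h`), so `B₂ − B = Im ∫ h₂′/h₂ − Im ∫ ζ′/ζ`;
  the `ζ`-term is the tree's, the `h₂`-term is Backlund's lemma with `|h₂| ≤ (15 + log(T+6)/2)·M(T)` on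
  the disc `|s − (2+iT)| ≤ 13/8` (Cauchy for `h′`) and the lower bound
  `|h₂(2+iT)| = |ζ(2+iT)| · |ξ″/ξ′(2+iT)| · |ξ′/ξ(2+iT)| ≥ (1/3) · (3/4)/(T² + 9/4) · 1`, where
  **`Re ξ″/ξ′(2+iT) ≥ (3/4)/(T² + 9/4)`** (`re_deriv2_div_deriv_two_add_ge`) is the QUANTITATIVE form of
  the Jensen-circle sign computation (pairing the zero `z = 0` of `Ξ′` with the point `T − 3i/2`).

Results: `exists_abs_xiDerivZeroCount_two_sub_zetaZeroCount_le_log` (`N^{(2)}(T) − N(T) = O(log T)`),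
`xiDerivZeroCount_two_riemann_von_mangoldt` (Conrey's printed form), and — with the `m`-fold Rolle bound
`(2/3 − ε) N(T) ≤ N^{(2)}₀(T)` of `XiHigherDerivativesCriticalZeros.lean` — the UNCONDITIONAL
**`two_thirds_le_xiDerivCriticalLineProportion_two : 2/3 ≤ κ′₂`** (Conrey: `κ′₂ ≥ 0.9584`, Levinson's
method, NOT proved here); §10: `N^{(2)}/N → 1`, any cumulative simple-critical proportion of `ζ` bounds
`κ′₂` (`le_xiDerivCriticalLineProportion_two_of_simpleCritical`), whence `κ′₂ ≥ 2 − c_MT⁻¹ ≥ 0.6725`. AI-produced formalisation (literature-prover-rh-lit-frontier-1-g12-0,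
2026-08-27); AI review is weaker than expert review. No endorsement of any preprint is implied.

## References

* J. B. Conrey, J. Number Theory 16 (1983) 49–74: Lemma 1 (p. 51), Lemma 2 (p. 52). [key `Conrey1983`]
* E. C. Titchmarsh, *The Theory of the Riemann Zeta-Function*, 2nd ed., §9.3–9.4. [key `Titchmarsh1986`]
-/

noncomputable section

open Complex Filter Set MeasureTheory Metric
open scoped Real Topology ComplexConjugate

namespace Literature.NumberTheory.LFunctions

open Literature.Analysis.Complex

namespace XiDeriv2Arg

/-! ## §1. `ξ″`, `ξ‴` and `F₂ = ξ‴/ξ″`: analyticity and symmetries -/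

/-- `ξ^{(2)} = ξ″` as iterated derivative (Conrey's `ξ^{(m)}`, `m = 2`). [cite: Conrey1983, §1 (p. 49)] -/
theorem iteratedDeriv_two_eq : iteratedDeriv 2 riemannXi = deriv (deriv riemannXi) := by
  rw [show (2 : ℕ) = 1 + 1 from rfl, iteratedDeriv_succ, iteratedDeriv_one]

/-- `ξ^{(3)} = ξ‴` as iterated derivative (Conrey's `ξ^{(m)}`, `m = 3`). [cite: Conrey1983, §1 (p. 49)] -/
theorem iteratedDeriv_three_eq : iteratedDeriv 3 riemannXi = deriv (deriv (deriv riemannXi)) := by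
  rw [show (3 : ℕ) = 2 + 1 from rfl, iteratedDeriv_succ, iteratedDeriv_two_eq]

/-- `ξ″` is differentiable. [cite: Conrey1983, Lemma 2 proof (p. 52)] -/
theorem differentiable_deriv2 : Differentiable ℂ (deriv (deriv riemannXi)) := fun z ↦
  (XiDerivArg.analyticOnNhd_deriv_deriv_riemannXi z trivial).differentiableAt

/-- `ξ‴` is analytic everywhere. [cite: Conrey1983, Lemma 2 proof (p. 52)] -/
theorem analyticOnNhd_deriv3 : AnalyticOnNhd ℂ (deriv (deriv (deriv riemannXi))) univ :=
  XiDerivArg.analyticOnNhd_deriv_deriv_riemannXi.deriv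

/-- `ξ‴(1 − s) = −ξ‴(s)`. [cite: Conrey1983, Lemma 2 proof (p. 52): ξ^{(m)}(s) = (−1)^m ξ^{(m)}(1 − s)] -/
theorem deriv3_one_sub (s : ℂ) :
    deriv (deriv (deriv riemannXi)) (1 - s) = -deriv (deriv (deriv riemannXi)) s := by
  have hfun : (fun z ↦ deriv (deriv riemannXi) (1 - z)) = fun z ↦ deriv (deriv riemannXi) z :=
    funext XiDerivArg.deriv_deriv_riemannXi_one_sub
  have hd : HasDerivAt (fun z ↦ deriv (deriv riemannXi) (1 - z))
      (deriv (deriv (deriv riemannXi)) (1 - s) * (-1)) s := by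
    have h1 : HasDerivAt (fun z : ℂ ↦ 1 - z) (-1) s := (hasDerivAt_id' s).const_sub 1
    exact (differentiable_deriv2 (1 - s)).hasDerivAt.comp s h1
  rw [hfun] at hd
  have h2 : HasDerivAt (fun z ↦ deriv (deriv riemannXi) z) (deriv (deriv (deriv riemannXi)) s) s :=
    (differentiable_deriv2 s).hasDerivAt
  have := hd.unique h2
  linear_combination (-1 : ℂ) * this

/-- `ξ‴(s̄) = conj ξ‴(s)`. [cite: Conrey1983, Lemma 2 proof (p. 52)] -/
theorem deriv3_conj (s : ℂ) :
    deriv (deriv (deriv riemannXi)) (conj s) = conj (deriv (deriv (deriv riemannXi)) s) := by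
  have h := iteratedDeriv_conj_of_conj riemannXi_conj_holds 3 s
  rwa [iteratedDeriv_three_eq] at h

/-- `F₂(1 − s) = −F₂(s)` for `F₂ = ξ‴/ξ″`. [cite: Conrey1983, Lemma 2 proof (p. 52)] -/
theorem logDeriv_deriv2_one_sub (s : ℂ) :
    deriv (deriv (deriv riemannXi)) (1 - s) / deriv (deriv riemannXi) (1 - s) =
      -(deriv (deriv (deriv riemannXi)) s / deriv (deriv riemannXi) s) := by
  rw [deriv3_one_sub, XiDerivArg.deriv_deriv_riemannXi_one_sub, neg_div]

/-- `F₂(s̄) = conj F₂(s)`. [cite: Conrey1983, Lemma 2 proof (p. 52)] -/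
theorem logDeriv_deriv2_conj (s : ℂ) :
    deriv (deriv (deriv riemannXi)) (conj s) / deriv (deriv riemannXi) (conj s) =
      conj (deriv (deriv (deriv riemannXi)) s / deriv (deriv riemannXi) s) := by
  rw [deriv3_conj, XiDerivArg.deriv_deriv_riemannXi_conj, map_div₀]

/-- `F₂` is continuous wherever `ξ″ ≠ 0`. [cite: Conrey1983, Lemma 2 proof (p. 52)] -/
theorem continuousAt_logDeriv_deriv2 {s : ℂ} (hs : deriv (deriv riemannXi) s ≠ 0) :
    ContinuousAt (fun z ↦ deriv (deriv (deriv riemannXi)) z / deriv (deriv riemannXi) z) s :=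
  (analyticOnNhd_deriv3 s trivial).continuousAt.div (differentiable_deriv2 s).continuousAt hs

/-- `ξ″(s) ≠ 0` for `Re s ≥ 1` (Lemma 2 for `m = 2`). [cite: Conrey1983, Lemma 2 (p. 52)] -/
theorem deriv2_ne_zero_of_one_le_re {s : ℂ} (hs : 1 ≤ s.re) : deriv (deriv riemannXi) s ≠ 0 := by
  have h := iteratedDeriv_riemannXi_ne_zero_of_one_le_re 2 hs
  rwa [iteratedDeriv_two_eq] at h

/-- `ξ″(s) ≠ 0` for `Re s ≤ 0`. [cite: Conrey1983, Lemma 2 (p. 52)] -/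
theorem deriv2_ne_zero_of_re_le_zero {s : ℂ} (hs : s.re ≤ 0) : deriv (deriv riemannXi) s ≠ 0 := by
  have h := iteratedDeriv_riemannXi_ne_zero_of_re_le_zero 2 hs
  rwa [iteratedDeriv_two_eq] at h

/-- **`ξ″` has no real zeros**: `ξ″(σ) > 0` for real `σ` (all Taylor coefficients of `ξ` at `½` of even
order are positive; Freitas 2006 Thm 2.2, tree `Freitas2006_thm_2_2_holds`). [cite: Titchmarsh1986, §10.1] -/
theorem deriv2_ofReal_ne_zero (σ : ℝ) : deriv (deriv riemannXi) σ ≠ 0 := by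
  have h := (Freitas2006_thm_2_2_holds σ 1).1
  rw [show 2 * 1 = 2 from rfl, iteratedDeriv_two_eq] at h
  intro h0
  rw [h0, Complex.zero_re] at h
  exact lt_irrefl _ h

/-- If no zero of `ξ″` has ordinate `T`, then `ξ″ ≠ 0` on the lines `Im s = ±T`.
[cite: Conrey1983, Lemma 2 proof (p. 52)] -/
theorem deriv2_ne_zero_of_im_eq {T : ℝ}
    (hT' : ∀ ρ : ℂ, deriv (deriv riemannXi) ρ = 0 → ρ.im ≠ T) {s : ℂ} (hs : s.im = T ∨ s.im = -T) :
    deriv (deriv riemannXi) s ≠ 0 := by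
  intro h0
  rcases hs with hs | hs
  · exact hT' s h0 hs
  · refine hT' (conj s) (by rw [XiDerivArg.deriv_deriv_riemannXi_conj, h0, map_zero]) ?_
    rw [conj_im, hs, neg_neg]

/-! ## §2. The zeros of `ξ″` in `(−1, 2) × (−T, T)` and their multiplicities -/

/-- The multiplicities of `ξ″` are symmetric under conjugation. [cite: Conrey1983, Lemma 2 proof (p. 52)] -/
theorem analyticOrderAt_deriv2_conj (s : ℂ) :
    analyticOrderAt (deriv (deriv riemannXi)) (conj s) = analyticOrderAt (deriv (deriv riemannXi)) s := by
  have ha : AnalyticAt ℂ (deriv (deriv riemannXi)) (conj s) :=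
    XiDerivArg.analyticOnNhd_deriv_deriv_riemannXi _ trivial
  rw [← analyticOrderAt_conj_conj ha]
  congr 1
  funext z
  rw [XiDerivArg.deriv_deriv_riemannXi_conj, conj_conj]

/-- The multiplicity of `ξ″` at any point is finite. [cite: Conrey1983, Lemma 2 proof (p. 52)] -/
theorem analyticOrderAt_deriv2_ne_top (s : ℂ) : analyticOrderAt (deriv (deriv riemannXi)) s ≠ ⊤ := by
  have h := XiDerivCritical.analyticOrderAt_ne_top 2 s
  rwa [iteratedDeriv_two_eq] at h

/-- `(meromorphicOrderAt ξ″ s).untop₀ = (analyticOrderAt ξ″ s).toNat` (as complex numbers).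
[cite: Conrey1983, Lemma 2 proof (p. 52)] -/
theorem untop₀_meromorphicOrderAt_deriv2 (s : ℂ) :
    ((meromorphicOrderAt (deriv (deriv riemannXi)) s).untop₀ : ℂ) =
      ((analyticOrderAt (deriv (deriv riemannXi)) s).toNat : ℂ) := by
  have ha : AnalyticAt ℂ (deriv (deriv riemannXi)) s := XiDerivArg.analyticOnNhd_deriv_deriv_riemannXi _ trivial
  obtain ⟨n, hn⟩ := ENat.ne_top_iff_exists.mp (analyticOrderAt_deriv2_ne_top s)
  rw [ha.meromorphicOrderAt_eq, ← hn, ENat.map_coe, WithTop.untop₀_coe, ENat.toNat_coe]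
  norm_cast

/-- **The zeros of `ξ″` in the open rectangle `(−1, 2) × (−T, T)`**, for `T > 0` not an ordinate of a
zero of `ξ″`: the zeros with `0 < Im s ≤ T` (`xiDerivZeroBox 2 T`) and their conjugates (all zeros of
`ξ″` have `0 < Re s < 1`, and none is real). [cite: Conrey1983, Lemma 2 (p. 52)] -/
theorem setOf_deriv2_eq_zero_eq_union {T : ℝ} (hT : 0 < T)
    (hT' : ∀ ρ : ℂ, deriv (deriv riemannXi) ρ = 0 → ρ.im ≠ T) :
    {ρ : ℂ | deriv (deriv riemannXi) ρ = 0 ∧ ρ ∈ Ioo (-1 : ℝ) 2 ×ℂ Ioo (-T) T} =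
      xiDerivZeroBox 2 T ∪ conj '' xiDerivZeroBox 2 T := by
  ext ρ
  simp only [mem_setOf_eq, mem_reProdIm, mem_Ioo, mem_union, mem_image, xiDerivZeroBox,
    iteratedDeriv_two_eq]
  constructor
  · rintro ⟨h0, ⟨-, -⟩, him1, him2⟩
    rcases lt_trichotomy ρ.im 0 with hneg | hzero | hpos
    · right
      refine ⟨conj ρ, ⟨by rw [XiDerivArg.deriv_deriv_riemannXi_conj, h0, map_zero], ?_, ?_⟩,
        conj_conj ρ⟩
      · rw [conj_im]; linarith
      · rw [conj_im]
        have : (conj ρ).im ≠ T := hT' (conj ρ)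
          (by rw [XiDerivArg.deriv_deriv_riemannXi_conj, h0, map_zero])
        rw [conj_im] at this
        exact le_of_lt (lt_of_le_of_ne (by linarith) this)
    · exfalso
      have hρ : ρ = (ρ.re : ℂ) := by
        apply Complex.ext <;> simp [hzero]
      rw [hρ] at h0
      exact deriv2_ofReal_ne_zero ρ.re h0
    · left
      exact ⟨h0, hpos, le_of_lt (lt_of_le_of_ne him2.le (hT' ρ h0))⟩
  · rintro (⟨h0, h1, h2⟩ | ⟨w, ⟨h0, h1, h2⟩, rfl⟩)
    · have hst := deriv2_riemannXi_eq_zero_re_mem h0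
      exact ⟨h0, ⟨by linarith [hst.1], by linarith [hst.2]⟩, by linarith,
        lt_of_le_of_ne h2 (hT' ρ h0)⟩
    · have hst := deriv2_riemannXi_eq_zero_re_mem h0
      have h0' : deriv (deriv riemannXi) (conj w) = 0 := by
        rw [XiDerivArg.deriv_deriv_riemannXi_conj, h0, map_zero]
      refine ⟨h0', ⟨?_, ?_⟩, ?_, ?_⟩
      · rw [conj_re]; linarith [hst.1]
      · rw [conj_re]; linarith [hst.2]
      · rw [conj_im]; have := lt_of_le_of_ne h2 (hT' w h0); linarith
      · rw [conj_im]; linarith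

/-- `(xiDerivZeroCount 2 T : ℂ)` is the `finsum` of the multiplicities of `ξ″` over the box.
[cite: Conrey1983, Lemma 2 (p. 52)] -/
theorem xiDerivZeroCount_two_eq_finsum (T : ℝ) :
    (xiDerivZeroCount 2 T : ℂ) =
      ∑ᶠ s ∈ xiDerivZeroBox 2 T, ((analyticOrderAt (deriv (deriv riemannXi)) s).toNat : ℂ) := by
  unfold xiDerivZeroCount
  rw [iteratedDeriv_two_eq]
  have h := (AddMonoidHom.map_finsum_mem (fun s ↦ (analyticOrderAt (deriv (deriv riemannXi)) s).toNat)
    (Nat.castAddMonoidHom ℂ) (XiDerivCritical.xiDerivZeroBox_finite 2 T)).symm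
  simpa using h.symm

/-- **The zeros of `ξ″` in `(−1, 2) × (−T, T)` number `2 N^{(2)}(T)`** (with multiplicity), for `T > 0`
not an ordinate of a zero of `ξ″`. [cite: Conrey1983, Lemma 2 (p. 52)] -/
theorem finsum_order_deriv2_eq {T : ℝ} (hT : 0 < T)
    (hT' : ∀ ρ : ℂ, deriv (deriv riemannXi) ρ = 0 → ρ.im ≠ T) :
    ∑ᶠ ρ ∈ {ρ : ℂ | deriv (deriv riemannXi) ρ = 0 ∧ ρ ∈ Ioo (-1 : ℝ) 2 ×ℂ Ioo (-T) T},
        ((meromorphicOrderAt (deriv (deriv riemannXi)) ρ).untop₀ : ℂ) =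
      2 * (xiDerivZeroCount 2 T : ℂ) := by
  rw [setOf_deriv2_eq_zero_eq_union hT hT']
  have hfin : (xiDerivZeroBox 2 T).Finite := XiDerivCritical.xiDerivZeroBox_finite 2 T
  have hdisj : Disjoint (xiDerivZeroBox 2 T) (conj '' xiDerivZeroBox 2 T) := by
    rw [Set.disjoint_left]
    rintro ρ ⟨-, h2, -⟩ ⟨w, ⟨-, hw2, -⟩, rfl⟩
    rw [conj_im] at h2
    linarith
  rw [finsum_mem_union hdisj hfin (hfin.image _),
    finsum_mem_image (starRingEnd ℂ).injective.injOn]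
  simp_rw [untop₀_meromorphicOrderAt_deriv2, analyticOrderAt_deriv2_conj]
  rw [← xiDerivZeroCount_two_eq_finsum]
  ring

/-! ## §3. The quarter-path identity for `ξ″` -/

/-- **Argument principle for `ξ″`, folded onto `2 → 2+iT → ½+iT`**: for `T > 0` not an ordinate of a
zero of `ξ″`, with `F₂ = ξ‴/ξ″`,
`∫₀ᵀ Re F₂(2+iy) dy − Im ∫_{1/2}^{2} F₂(x+iT) dx = π N^{(2)}(T)`. [cite: Conrey1983, Lemma 2 (p. 52)] -/
theorem quarter_path_eq_xiDeriv2 {T : ℝ} (hT : 0 < T)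
    (hT' : ∀ ρ : ℂ, deriv (deriv riemannXi) ρ = 0 → ρ.im ≠ T) :
    (∫ y in (0 : ℝ)..T, (deriv (deriv (deriv riemannXi)) (2 + y * I) /
        deriv (deriv riemannXi) (2 + y * I)).re) -
      (∫ x in (1 / 2 : ℝ)..2, deriv (deriv (deriv riemannXi)) (x + T * I) /
        deriv (deriv riemannXi) (x + T * I)).im =
      π * xiDerivZeroCount 2 T := by
  set F₂ : ℂ → ℂ := fun z ↦ deriv (deriv (deriv riemannXi)) z / deriv (deriv riemannXi) z with hF₂
  have hAP := Literature.Analysis.Complex.integral_boundary_rect_logDeriv (f := deriv (deriv riemannXi))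
    (a := -1) (b := 2) (c := -T) (d := T) (by norm_num) (by linarith)
    (fun z _ ↦ XiDerivArg.analyticOnNhd_deriv_deriv_riemannXi z trivial)
    (fun x _ ↦ deriv2_ne_zero_of_im_eq hT' (Or.inr (by simp)))
    (fun x _ ↦ deriv2_ne_zero_of_im_eq hT' (Or.inl (by simp)))
    (fun y _ ↦ deriv2_ne_zero_of_re_le_zero (by simp))
    (fun y _ ↦ deriv2_ne_zero_of_one_le_re (by simp))
  rw [finsum_order_deriv2_eq hT hT'] at hAP
  have hAP' : Literature.Analysis.Complex.rectBoundaryIntegral F₂ (-1) 2 (-T) T =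
      2 * Real.pi * I * (2 * (xiDerivZeroCount 2 T : ℂ)) := by
    rw [Literature.Analysis.Complex.rectBoundaryIntegral_def]
    exact hAP
  have hfold := rectBoundaryIntegral_eq_of_symmetric (F := F₂) hT.le
    (fun s ↦ logDeriv_deriv2_one_sub s) (fun s ↦ logDeriv_deriv2_conj s)
    (fun y _ ↦ continuousAt_logDeriv_deriv2 (deriv2_ne_zero_of_one_le_re (by simp)))
    (fun x _ ↦ continuousAt_logDeriv_deriv2 (deriv2_ne_zero_of_im_eq hT' (Or.inl (by simp))))
  rw [hfold] at hAP'
  set A : ℝ := ∫ y in (0 : ℝ)..T, (F₂ (2 + y * I)).re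
  set B : ℂ := ∫ x in (1 / 2 : ℝ)..2, F₂ (x + T * I)
  have := congrArg Complex.im hAP'
  simp only [mul_im, mul_re, I_re, I_im, ofReal_re, ofReal_im, sub_re, sub_im, re_ofNat, im_ofNat,
    natCast_re, natCast_im] at this
  simp at this
  linarith

/-! ## §4. The vertical edge: `F₂ − F₁ = g₁′/g₁` with `Re g₁ > 0` on `Re s = 2`, `g₁ = ξ″/ξ′` -/

/-- Pointwise, `ξ‴/ξ″ − ξ″/ξ′ = g₁′/g₁` for `g₁ = ξ″/ξ′`, wherever `ξ′ ξ″ ≠ 0`.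
[cite: Conrey1983, Lemma 2 proof (p. 52)] -/
theorem logDeriv_deriv2_sub_logDeriv_deriv_eq {z : ℂ} (h1 : deriv riemannXi z ≠ 0)
    (h2 : deriv (deriv riemannXi) z ≠ 0) :
    deriv (deriv (deriv riemannXi)) z / deriv (deriv riemannXi) z -
        deriv (deriv riemannXi) z / deriv riemannXi z =
      deriv (fun w ↦ deriv (deriv riemannXi) w / deriv riemannXi w) z /
        (deriv (deriv riemannXi) z / deriv riemannXi z) := by
  have hd : deriv (fun w ↦ deriv (deriv riemannXi) w / deriv riemannXi w) z =
      (deriv (deriv (deriv riemannXi)) z * deriv riemannXi z -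
        deriv (deriv riemannXi) z * deriv (deriv riemannXi) z) / deriv riemannXi z ^ 2 :=
    deriv_div (differentiable_deriv2 z) (differentiable_deriv_riemannXi z) h1
  rw [hd]
  field_simp

/-- **The vertical edge, second step, contributes at most `π`**: with `F₂ = ξ‴/ξ″`, `F₁ = ξ″/ξ′`,
`|∫₀ᵀ Re F₂(2+iy) dy − ∫₀ᵀ Re F₁(2+iy) dy| ≤ π`, because the difference is `arg g₁(2+iT) − arg g₁(2)` for
`g₁ = ξ″/ξ′` and `Re g₁ > 0` on `Re s = 2` (Conrey's inequality for `m = 1`).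
[cite: Conrey1983, Lemma 2 proof (p. 52)] -/
theorem abs_vertical_sub_le₂ {T : ℝ} (hT : 0 ≤ T) :
    |(∫ y in (0 : ℝ)..T, (deriv (deriv (deriv riemannXi)) (2 + y * I) /
        deriv (deriv riemannXi) (2 + y * I)).re) -
      (∫ y in (0 : ℝ)..T, (deriv (deriv riemannXi) (2 + y * I) / deriv riemannXi (2 + y * I)).re)| ≤
      π := by
  set g : ℂ → ℂ := fun w ↦ deriv (deriv riemannXi) w / deriv riemannXi w with hg
  set F₂ : ℂ → ℂ := fun w ↦ deriv (deriv (deriv riemannXi)) w / deriv (deriv riemannXi) w with hF₂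
  have hξ' : ∀ y : ℝ, deriv riemannXi (2 + y * I) ≠ 0 := fun y ↦
    deriv_riemannXi_ne_zero_of_one_le_re (by simp)
  have hξ'' : ∀ y : ℝ, deriv (deriv riemannXi) (2 + y * I) ≠ 0 := fun y ↦
    deriv2_ne_zero_of_one_le_re (by simp)
  have hre : ∀ y : ℝ, 0 < (g (2 + y * I)).re := fun y ↦
    re_deriv2_div_deriv_riemannXi_pos_of_one_le_re (s := 2 + y * I) (by simp)
  have hgan : ∀ y : ℝ, AnalyticAt ℂ g (2 + y * I) := fun y ↦
    (XiDerivArg.analyticOnNhd_deriv_deriv_riemannXi _ trivial).div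
      (XiDerivCount.analyticOnNhd_deriv_riemannXi _ trivial) (hξ' y)
  have han : ∀ y ∈ Icc 0 T, AnalyticAt ℂ g ((2 : ℝ) + y * I) := fun y _ ↦ by
    simpa using hgan y
  have hslit : ∀ y ∈ Icc 0 T, g ((2 : ℝ) + y * I) ∈ slitPlane := fun y _ ↦
    Or.inl (by simpa using hre y)
  have hlog := Literature.Analysis.Complex.integral_logDeriv_vertical (g := g) 2 hT han hslit
  simp only [ofReal_ofNat, ofReal_zero, zero_mul, add_zero] at hlog
  have hi1 : IntervalIntegrable (fun y : ℝ ↦ F₂ (2 + y * I)) volume 0 T := by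
    have := Literature.Analysis.Complex.intervalIntegrable_of_continuousAt_vertical (F := F₂) 2 hT
      fun y _ ↦ continuousAt_logDeriv_deriv2 (by simpa using hξ'' y)
    simpa using this
  have hi2 : IntervalIntegrable (fun y : ℝ ↦ g (2 + y * I)) volume 0 T := by
    have := Literature.Analysis.Complex.intervalIntegrable_of_continuousAt_vertical (F := g) 2 hT
      fun y _ ↦ XiDerivArg.continuousAt_logDeriv_deriv_riemannXi (by simpa using hξ' y)
    simpa using this
  have hre1 : (∫ y in (0 : ℝ)..T, (F₂ (2 + y * I)).re) = (∫ y in (0 : ℝ)..T, F₂ (2 + y * I)).re := by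
    have := ContinuousLinearMap.intervalIntegral_comp_comm (𝕜 := ℝ) reCLM hi1
    simpa using this
  have hre2 : (∫ y in (0 : ℝ)..T, (g (2 + y * I)).re) = (∫ y in (0 : ℝ)..T, g (2 + y * I)).re := by
    have := ContinuousLinearMap.intervalIntegral_comp_comm (𝕜 := ℝ) reCLM hi2
    simpa using this
  have hsub : (∫ y in (0 : ℝ)..T, F₂ (2 + y * I)) - (∫ y in (0 : ℝ)..T, g (2 + y * I)) =
      ∫ y in (0 : ℝ)..T, deriv g (2 + y * I) / g (2 + y * I) := by
    rw [← intervalIntegral.integral_sub hi1 hi2]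
    refine intervalIntegral.integral_congr fun y _ ↦ ?_
    exact logDeriv_deriv2_sub_logDeriv_deriv_eq (hξ' y) (hξ'' y)
  have key : (∫ y in (0 : ℝ)..T, (F₂ (2 + y * I)).re) - (∫ y in (0 : ℝ)..T, (g (2 + y * I)).re) =
      (Complex.log (g (2 + T * I)) - Complex.log (g 2)).im := by
    rw [hre1, hre2, ← sub_re, hsub, ← hlog]
    simp
  show |(∫ y in (0 : ℝ)..T, (F₂ (2 + y * I)).re) - (∫ y in (0 : ℝ)..T, (g (2 + y * I)).re)| ≤ π
  rw [key, sub_im, log_im, log_im]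
  have a1 := abs_arg_le_pi_div_two_iff.2 (hre T).le
  have a2 := abs_arg_le_pi_div_two_iff.2 (hre 0).le
  simp only [ofReal_zero, zero_mul, add_zero] at a2
  have := abs_sub (arg (g (2 + T * I))) (arg (g 2))
  linarith

/-! ## §5. The quantitative sign of `Im Ξ″/Ξ′` and `Re ξ″/ξ′(2+iT) ≥ (3/4)/(T² + 9/4)` -/

/-- **Quantitative Jensen-circle sign lemma.** Let `f` be real entire of order `< 2` with a zero `a₀`,
let `w` be non-real and strictly outside every closed Jensen disc of `f`. Then
`(Im w) · Im (f′/f)(w) ≤ −(Im w)² (|w − Re a₀|² − (Im a₀)²)/(2 |w − a₀|² |w − ā₀|²)` (the pair term of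
`a₀` alone, up to the factor `1/4` lost in Titchmarsh's approximation).
[cite: KiKim2000, §2 p. 50 (Jensen's theorem, proof)] -/
theorem im_mul_im_logDeriv_le {f : ℂ → ℂ} (hf : Differentiable ℂ f) {ρ C : ℝ} (hρ0 : 0 ≤ ρ)
    (hρ : ρ < 2) (hgr : ∀ z, ‖f z‖ ≤ C * Real.exp (‖z‖ ^ ρ)) (hreal : ∀ x : ℝ, (f x).im = 0)
    {a₀ : ℂ} (ha₀ : f a₀ = 0) {w : ℂ} (hw : w.im ≠ 0)
    (hout : ∀ a, f a = 0 → |a.im| < ‖w - a.re‖) :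
    w.im * (deriv f w / f w).im ≤
      -(w.im ^ 2 * (‖w - a₀.re‖ ^ 2 - a₀.im ^ 2) / (2 * (‖w - a₀‖ ^ 2 * ‖w - conj a₀‖ ^ 2))) := by
  classical
  have hfw0 : f w ≠ 0 := by
    intro h0
    have h := hout w h0
    have e : w - (w.re : ℂ) = (w.im : ℂ) * I := by apply Complex.ext <;> simp
    rw [e, norm_mul, Complex.norm_I, mul_one, Complex.norm_real, Real.norm_eq_abs] at h
    exact lt_irrefl _ h
  have hfw0' : f (conj w) ≠ 0 := by
    rw [apply_conj_eq_conj hf hreal, map_ne_zero]; exact hfw0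
  obtain ⟨c, hc⟩ := exists_ofReal_ne_zero hf ⟨w, hfw0⟩
  obtain ⟨-, hκ⟩ := im_mul_im_pair_le (hout a₀ ha₀) hw (le_refl 1)
  set κ : ℝ := 2 * w.im ^ 2 * (‖w - a₀.re‖ ^ 2 - a₀.im ^ 2) /
    (‖w - a₀‖ ^ 2 * ‖w - conj a₀‖ ^ 2) with hκdef
  have hε : 0 < κ / (2 * (|w.im| + 1)) := by positivity
  obtain ⟨S, m, ψ₁, ψ₂, hS, hS', h1, h2, hψ⟩ :=
    exists_logDeriv_eq_sum_pair hf hρ0 hρ hgr hc hfw0 hfw0' ‖a₀ - c‖ hε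
  have ha₀S : a₀ ∈ S := hS' a₀ ha₀ le_rfl
  set g : ℂ := deriv f w / f w with hgdef
  have hg2 : deriv f (conj w) / f (conj w) = conj g := by
    rw [hgdef, logDeriv_apply_conj hf hreal]
  have h2' : g = ∑ a ∈ S, (m a : ℂ) / (w - conj a) + conj ψ₂ := by
    have h2c : conj g = ∑ a ∈ S, (m a : ℂ) / (conj w - a) + ψ₂ := by rw [← hg2]; exact h2
    have := congrArg conj h2c
    rw [Complex.conj_conj, map_add, map_sum] at this
    rw [this]
    congr 1
    refine Finset.sum_congr rfl fun a _ ↦ ?_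
    rw [map_div₀, map_natCast, map_sub, Complex.conj_conj]
  have hsum : ∑ a ∈ S, w.im * ((m a : ℂ) / (w - a) + (m a : ℂ) / (w - conj a)).im =
      w.im * (g.im + g.im - ψ₁.im + ψ₂.im) := by
    have e : ∑ a ∈ S, ((m a : ℂ) / (w - a) + (m a : ℂ) / (w - conj a)) =
        g + g - ψ₁ - conj ψ₂ := by
      rw [Finset.sum_add_distrib]
      have e1 : ∑ a ∈ S, (m a : ℂ) / (w - a) = g - ψ₁ := eq_sub_of_add_eq h1.symm
      have e2 : ∑ a ∈ S, (m a : ℂ) / (w - conj a) = g - conj ψ₂ := eq_sub_of_add_eq h2'.symm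
      rw [e1, e2]; ring
    rw [← Finset.mul_sum, ← Complex.im_sum, e]
    simp only [Complex.sub_im, Complex.add_im, Complex.conj_im]
    ring
  have hle : ∑ a ∈ S, w.im * ((m a : ℂ) / (w - a) + (m a : ℂ) / (w - conj a)).im ≤ -κ := by
    rw [← Finset.add_sum_erase S _ ha₀S]
    have hrest : ∑ a ∈ S.erase a₀, w.im * ((m a : ℂ) / (w - a) + (m a : ℂ) / (w - conj a)).im
        ≤ 0 :=
      Finset.sum_nonpos fun a ha ↦
        im_mul_im_pair_nonpos (hout a (hS a (Finset.mem_of_mem_erase ha)).1) (m a)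
    have hfirst := (im_mul_im_pair_le (hout a₀ ha₀) hw (hS a₀ ha₀S).2).1
    rw [← hκdef] at hfirst
    linarith
  have hψim : |ψ₂.im - ψ₁.im| ≤ κ / (2 * (|w.im| + 1)) := by
    calc |ψ₂.im - ψ₁.im| = |(ψ₁ - ψ₂).im| := by rw [Complex.sub_im, abs_sub_comm]
      _ ≤ ‖ψ₁ - ψ₂‖ := Complex.abs_im_le_norm _
      _ ≤ κ / (2 * (|w.im| + 1)) := hψ
  have hprod : |w.im * (ψ₂.im - ψ₁.im)| ≤ |w.im| * (κ / (2 * (|w.im| + 1))) := by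
    rw [abs_mul]; exact mul_le_mul_of_nonneg_left hψim (abs_nonneg _)
  have hle2 : |w.im| * (κ / (2 * (|w.im| + 1))) ≤ κ / 2 := by
    rw [← mul_div_assoc, div_le_iff₀ (by positivity)]
    nlinarith [abs_nonneg w.im, hκ.le]
  have hD : w.im * (g.im + g.im - ψ₁.im + ψ₂.im) =
      2 * (w.im * g.im) + w.im * (ψ₂.im - ψ₁.im) := by ring
  rw [hsum, hD] at hle
  have h3 := neg_le_abs (w.im * (ψ₂.im - ψ₁.im))
  have hgoal : -(w.im ^ 2 * (‖w - a₀.re‖ ^ 2 - a₀.im ^ 2) /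
      (2 * (‖w - a₀‖ ^ 2 * ‖w - conj a₀‖ ^ 2))) = -(κ / 4) := by
    rw [hκdef]; ring
  rw [hgoal, hgdef] at *
  linarith

/-- **`Re ξ″/ξ′(2 + iT) ≥ (3/4)/(T² + 9/4)`** for every real `T`: the quantitative sign lemma for
`f = Ξ′` (real entire of order `< 2`, zeros with `|Im| < ½`), the zero `a₀ = 0` of `Ξ′`, and the point
`w = T − 3i/2` (`½ + iw = 2 + iT`, `Re ξ″/ξ′(2+iT) = Im (Ξ″/Ξ′)(w)`).
[cite: Conrey1983, Lemma 2 proof (p. 52)] -/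
theorem re_deriv2_div_deriv_two_add_ge (T : ℝ) :
    (3 / 4) / (T ^ 2 + 9 / 4) ≤
      (deriv (deriv riemannXi) (2 + T * I) / deriv riemannXi (2 + T * I)).re := by
  obtain ⟨ρ, C, hρ0, hρ, hgr⟩ := exists_growth_riemannXiUpper
  obtain ⟨ρ', C', hρ'0, hρ', hgr'⟩ :=
    exists_growth_iteratedDeriv XiDerivStrip.differentiable_xiUpper hρ0 hρ hgr 1
  set f : ℂ → ℂ := iteratedDeriv 1 riemannXiUpper with hf
  have hfd : Differentiable ℂ f :=
    differentiable_iteratedDeriv_of_entire XiDerivStrip.differentiable_xiUpper 1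
  have hreal : ∀ x : ℝ, (f x).im = 0 :=
    im_iteratedDeriv_ofReal XiDerivStrip.differentiable_xiUpper im_riemannXiUpper_ofReal_holds 1
  have ha₀ : f 0 = 0 := iteratedDeriv_riemannXiUpper_zero_of_odd odd_one
  set w : ℂ := (T : ℂ) - 3 / 2 * I with hw
  have hsz : 1 / 2 + I * w = 2 + T * I := by
    rw [hw]; ring_nf; rw [I_sq]; ring
  have hwim : w.im = -(3 / 2) := by simp [hw]
  have hwre : w.re = T := by simp [hw]
  have hwim_ne : w.im ≠ 0 := by rw [hwim]; norm_num
  have hout : ∀ a, f a = 0 → |a.im| < ‖w - a.re‖ := by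
    intro a ha
    have h1 := abs_im_lt_half_of_iteratedDeriv_riemannXiUpper_eq_zero 1 ha
    have h2 : |(w - (a.re : ℂ)).im| ≤ ‖w - (a.re : ℂ)‖ := Complex.abs_im_le_norm _
    have h3 : (w - (a.re : ℂ)).im = w.im := by simp
    rw [h3, hwim] at h2
    norm_num at h2
    linarith
  have hq := im_mul_im_logDeriv_le hfd hρ'0 hρ' hgr' hreal ha₀ hwim_ne hout
  -- evaluate the right-hand side at `a₀ = 0`
  have hnw : ‖w‖ ^ 2 = T ^ 2 + 9 / 4 := by
    rw [← Complex.normSq_eq_norm_sq, Complex.normSq_apply, hwre, hwim]; ring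
  have hnw0 : 0 < ‖w‖ ^ 2 := by rw [hnw]; positivity
  simp only [zero_re, zero_im, ofReal_zero, sub_zero, map_zero] at hq
  rw [hwim, hnw] at hq
  -- `hq : -(3/2) * Im q ≤ -((9/4) * (T²+9/4) / (2 * ((T²+9/4) * (T²+9/4))))`
  have hval : (3 / 2 : ℝ) ^ 2 * (T ^ 2 + 9 / 4 - 0 ^ 2) / (2 * ((T ^ 2 + 9 / 4) * (T ^ 2 + 9 / 4))) =
      (9 / 8) / (T ^ 2 + 9 / 4) := by
    field_simp
    ring
  have hq' : (3 / 4) / (T ^ 2 + 9 / 4) ≤ (deriv f w / f w).im := by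
    have hpos : 0 < T ^ 2 + 9 / 4 := by positivity
    rw [show (-(3 / 2) : ℝ) ^ 2 = (3 / 2 : ℝ) ^ 2 by norm_num, hval] at hq
    rw [div_le_iff₀ hpos]
    have := mul_le_mul_of_nonneg_right hq hpos.le
    have e : (9 / 8) / (T ^ 2 + 9 / 4) * (T ^ 2 + 9 / 4) = 9 / 8 := by field_simp
    nlinarith [e]
  -- `deriv f w / f w = I · ξ″/ξ′(2+iT)`
  have hquot : deriv f w / f w =
      I * (deriv (deriv riemannXi) (2 + T * I) / deriv riemannXi (2 + T * I)) := by
    rw [hf, ← iteratedDeriv_succ, iteratedDeriv_riemannXiUpper, iteratedDeriv_riemannXiUpper, hsz,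
      pow_succ, mul_assoc, mul_div_mul_left _ _ (pow_ne_zero _ I_ne_zero), mul_div_assoc,
      iteratedDeriv_two_eq, iteratedDeriv_one]
  rw [hquot, Complex.I_mul_im] at hq'
  exact hq'

/-! ## §6. The horizontal edge: `ξ″/ξ = h₂/ζ` with `h₂ = h′ + G h` analytic, and Backlund's lemma for `h₂` -/

/-- `F′ + F² = ξ″/ξ` for `F = ξ′/ξ`, wherever `ξ ≠ 0`. [cite: Conrey1983, Lemma 2 proof (p. 52)] -/
theorem deriv_logDeriv_add_sq {z : ℂ} (h0 : riemannXi z ≠ 0) :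
    deriv (fun w ↦ deriv riemannXi w / riemannXi w) z + (deriv riemannXi z / riemannXi z) ^ 2 =
      deriv (deriv riemannXi) z / riemannXi z := by
  have hd : deriv (fun w ↦ deriv riemannXi w / riemannXi w) z =
      (deriv (deriv riemannXi) z * riemannXi z - deriv riemannXi z * deriv riemannXi z) /
        riemannXi z ^ 2 :=
    deriv_div (differentiable_deriv_riemannXi z) (differentiable_riemannXi z) h0
  rw [hd]
  field_simp
  ring

/-- **The derivative of `h`**: for `Re z > 0`, `z ≠ 1`, `ζ(z) ≠ 0`, with `F = ξ′/ξ`,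
`h′(z) = ζ′(z) F(z) + ζ(z) F′(z)` (`h = ζ F` near `z`). [cite: Conrey1983, Lemma 2 proof (p. 52)] -/
theorem deriv_h_eq {z : ℂ} (hz : 0 < z.re) (hz1 : z ≠ 1) (hζ : riemannZeta z ≠ 0) :
    deriv (fun w ↦ deriv riemannZeta w + (w⁻¹ + (w - 1)⁻¹ + logDeriv Gammaℝ w) * riemannZeta w) z =
      deriv riemannZeta z * (deriv riemannXi z / riemannXi z) +
        riemannZeta z * deriv (fun w ↦ deriv riemannXi w / riemannXi w) z := by
  have hξ : riemannXi z ≠ 0 := fun h0 ↦ hζ ((riemannXi_eq_zero_iff_holds z).1 h0).1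
  have hU : ∀ᶠ w in 𝓝 z,
      (fun w ↦ deriv riemannZeta w + (w⁻¹ + (w - 1)⁻¹ + logDeriv Gammaℝ w) * riemannZeta w) w =
        riemannZeta w * (deriv riemannXi w / riemannXi w) := by
    have e1 : ∀ᶠ w in 𝓝 z, 0 < w.re := (isOpen_lt continuous_const continuous_re).mem_nhds hz
    have e2 : ∀ᶠ w in 𝓝 z, w ≠ 1 := eventually_ne_nhds hz1
    have e3 : ∀ᶠ w in 𝓝 z, riemannZeta w ≠ 0 :=
      (differentiableAt_riemannZeta hz1).continuousAt.eventually_ne hζ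
    filter_upwards [e1, e2, e3] with w hw hw1 hwζ
    exact XiDerivArg.h_eq_zeta_mul_logDeriv hw hw1 hwζ
  rw [Filter.EventuallyEq.deriv_eq hU]
  have hFd : DifferentiableAt ℂ (fun w ↦ deriv riemannXi w / riemannXi w) z :=
    ((differentiable_deriv_riemannXi z).div (differentiable_riemannXi z) hξ)
  have hζd : DifferentiableAt ℂ riemannZeta z := differentiableAt_riemannZeta hz1
  exact deriv_fun_mul hζd hFd

/-- **`h₂ = h′ + G h = ζ · ξ″/ξ`** for `Re z > 0`, `z ≠ 1`, `ζ(z) ≠ 0`.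
[cite: Conrey1983, Lemma 2 proof (p. 52)] -/
theorem h2_eq_zeta_mul {z : ℂ} (hz : 0 < z.re) (hz1 : z ≠ 1) (hζ : riemannZeta z ≠ 0) :
    deriv (fun w ↦ deriv riemannZeta w + (w⁻¹ + (w - 1)⁻¹ + logDeriv Gammaℝ w) * riemannZeta w) z +
        (z⁻¹ + (z - 1)⁻¹ + logDeriv Gammaℝ z) *
          (deriv riemannZeta z + (z⁻¹ + (z - 1)⁻¹ + logDeriv Gammaℝ z) * riemannZeta z) =
      riemannZeta z * (deriv (deriv riemannXi) z / riemannXi z) := by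
  have hξ : riemannXi z ≠ 0 := fun h0 ↦ hζ ((riemannXi_eq_zero_iff_holds z).1 h0).1
  rw [deriv_h_eq hz hz1 hζ, XiDerivArg.h_eq_zeta_mul_logDeriv hz hz1 hζ, ← deriv_logDeriv_add_sq hξ]
  have hG : z⁻¹ + (z - 1)⁻¹ + logDeriv Gammaℝ z =
      deriv riemannXi z / riemannXi z - deriv riemannZeta z / riemannZeta z := by
    rw [logDeriv_riemannXi_eq_add_logDeriv_riemannZeta hz hz1 hζ]; ring
  rw [hG]
  field_simp
  ring

/-- `h₂` is analytic at every `z` with `Re z > 0`, `z ≠ 1`. [cite: Conrey1983, Lemma 2 proof (p. 52)] -/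
theorem analyticAt_h2 {z : ℂ} (hz : 0 < z.re) (hz1 : z ≠ 1) :
    AnalyticAt ℂ (fun w ↦
      deriv (fun u ↦ deriv riemannZeta u + (u⁻¹ + (u - 1)⁻¹ + logDeriv Gammaℝ u) * riemannZeta u) w +
        (w⁻¹ + (w - 1)⁻¹ + logDeriv Gammaℝ w) *
          (deriv riemannZeta w + (w⁻¹ + (w - 1)⁻¹ + logDeriv Gammaℝ w) * riemannZeta w)) z := by
  have hh : AnalyticAt ℂ
      (fun u ↦ deriv riemannZeta u + (u⁻¹ + (u - 1)⁻¹ + logDeriv Gammaℝ u) * riemannZeta u) z :=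
    XiDerivArg.analyticAt_h hz hz1
  have hz0 : z ≠ 0 := fun h ↦ by rw [h, zero_re] at hz; exact lt_irrefl _ hz
  have hG : AnalyticAt ℂ (fun w : ℂ ↦ w⁻¹ + (w - 1)⁻¹ + logDeriv Gammaℝ w) z :=
    ((analyticAt_id.inv hz0).add ((analyticAt_id.sub analyticAt_const).inv (sub_ne_zero.2 hz1))).add
      (analyticAt_logDeriv_Gammaℝ hz)
  exact hh.deriv.add (hG.mul hh)

/-- **`ξ‴/ξ″ − ξ′/ξ = h₂′/h₂ − ζ′/ζ` on the top edge**: for `Re z > 0`, `z ≠ 1`, `ζ(z) ≠ 0`, `ξ″(z) ≠ 0`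
(`g₂ = ξ″/ξ` agrees with `h₂/ζ` near `z`). [cite: Conrey1983, Lemma 2 proof (p. 52)] -/
theorem logDeriv_deriv2_sub_logDeriv_eq_h2 {z : ℂ} (hz : 0 < z.re) (hz1 : z ≠ 1)
    (hζ : riemannZeta z ≠ 0) (hξ2 : deriv (deriv riemannXi) z ≠ 0) :
    deriv (deriv (deriv riemannXi)) z / deriv (deriv riemannXi) z - deriv riemannXi z / riemannXi z =
      deriv (fun w ↦
          deriv (fun u ↦ deriv riemannZeta u + (u⁻¹ + (u - 1)⁻¹ + logDeriv Gammaℝ u) * riemannZeta u) w +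
            (w⁻¹ + (w - 1)⁻¹ + logDeriv Gammaℝ w) *
              (deriv riemannZeta w + (w⁻¹ + (w - 1)⁻¹ + logDeriv Gammaℝ w) * riemannZeta w)) z /
          (fun w ↦
            deriv (fun u ↦ deriv riemannZeta u + (u⁻¹ + (u - 1)⁻¹ + logDeriv Gammaℝ u) *
              riemannZeta u) w +
              (w⁻¹ + (w - 1)⁻¹ + logDeriv Gammaℝ w) *
                (deriv riemannZeta w + (w⁻¹ + (w - 1)⁻¹ + logDeriv Gammaℝ w) * riemannZeta w)) z -
        deriv riemannZeta z / riemannZeta z := by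
  set h₂ : ℂ → ℂ := fun w ↦
    deriv (fun u ↦ deriv riemannZeta u + (u⁻¹ + (u - 1)⁻¹ + logDeriv Gammaℝ u) * riemannZeta u) w +
      (w⁻¹ + (w - 1)⁻¹ + logDeriv Gammaℝ w) *
        (deriv riemannZeta w + (w⁻¹ + (w - 1)⁻¹ + logDeriv Gammaℝ w) * riemannZeta w) with hh₂
  set g : ℂ → ℂ := fun w ↦ deriv (deriv riemannXi) w / riemannXi w with hg
  have hξ : riemannXi z ≠ 0 := fun h0 ↦ hζ ((riemannXi_eq_zero_iff_holds z).1 h0).1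
  have hU : ∀ᶠ w in 𝓝 z, g w = h₂ w / riemannZeta w := by
    have e1 : ∀ᶠ w in 𝓝 z, 0 < w.re := (isOpen_lt continuous_const continuous_re).mem_nhds hz
    have e2 : ∀ᶠ w in 𝓝 z, w ≠ 1 := eventually_ne_nhds hz1
    have e3 : ∀ᶠ w in 𝓝 z, riemannZeta w ≠ 0 :=
      (differentiableAt_riemannZeta hz1).continuousAt.eventually_ne hζ
    filter_upwards [e1, e2, e3] with w hw hw1 hwζ
    simp only [hg, hh₂]
    rw [eq_div_iff hwζ, h2_eq_zeta_mul hw hw1 hwζ]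
    ring
  have hgz : g z = h₂ z / riemannZeta z :=
    Filter.Eventually.self_of_nhds (p := fun w ↦ g w = h₂ w / riemannZeta w) hU
  have hgz' : deriv g z = deriv (fun w ↦ h₂ w / riemannZeta w) z :=
    Filter.EventuallyEq.deriv_eq hU
  have hh_an : AnalyticAt ℂ h₂ z := analyticAt_h2 hz hz1
  have hζ_diff : DifferentiableAt ℂ riemannZeta z := differentiableAt_riemannZeta hz1
  have hdiv : deriv (fun w ↦ h₂ w / riemannZeta w) z =
      (deriv h₂ z * riemannZeta z - h₂ z * deriv riemannZeta z) / riemannZeta z ^ 2 :=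
    deriv_div hh_an.differentiableAt hζ_diff hζ
  have hgne : g z ≠ 0 := div_ne_zero hξ2 hξ
  have hhz : h₂ z ≠ 0 := by
    intro h0
    rw [hgz, h0, zero_div] at hgne
    exact hgne rfl
  -- `g′/g = ξ‴/ξ″ − ξ′/ξ`
  have hgd : deriv g z = (deriv (deriv (deriv riemannXi)) z * riemannXi z -
      deriv (deriv riemannXi) z * deriv riemannXi z) / riemannXi z ^ 2 :=
    deriv_div (differentiable_deriv2 z) (differentiable_riemannXi z) hξ
  have hlhs : deriv (deriv (deriv riemannXi)) z / deriv (deriv riemannXi) z -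
      deriv riemannXi z / riemannXi z = deriv g z / g z := by
    rw [hgd, hg]
    field_simp
  rw [hlhs]
  show deriv g z / g z = deriv h₂ z / h₂ z - deriv riemannZeta z / riemannZeta z
  rw [hgz', hdiv, hgz]
  field_simp

/-- Points of the disc `|z − (2 + iT)| ≤ r`: `|Re z − 2| ≤ r` and `|Im z − T| ≤ r`. [folklore] -/
private theorem mem_disc_bounds {T r : ℝ} {z : ℂ} (hz : z ∈ closedBall ((2 : ℂ) + T * I) r) :
    |z.re - 2| ≤ r ∧ |z.im - T| ≤ r := by
  rw [mem_closedBall, dist_eq_norm] at hz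
  have h1 := abs_re_le_norm (z - (2 + T * I))
  have h2 := abs_im_le_norm (z - (2 + T * I))
  have e1 : (z - (2 + T * I)).re = z.re - 2 := by simp
  have e2 : (z - (2 + T * I)).im = z.im - T := by simp
  rw [e1] at h1
  rw [e2] at h2
  exact ⟨h1.trans hz, h2.trans hz⟩

/-- `|G(z)| ≤ 7 + log(T+6)/2` on the disc `|z − (2+iT)| ≤ 7/4`, `T ≥ 4`, for
`G(z) = 1/z + 1/(z−1) + Γℝ′/Γℝ(z)`. [cite: Conrey1983, Lemma 1 (b) (p. 51)] -/
theorem norm_G_le_disc {T : ℝ} (hT : 4 ≤ T) {z : ℂ} (hz : z ∈ closedBall ((2 : ℂ) + T * I) (7 / 4)) :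
    ‖z⁻¹ + (z - 1)⁻¹ + logDeriv Gammaℝ z‖ ≤ 7 + Real.log (T + 6) / 2 := by
  obtain ⟨hre, him⟩ := mem_disc_bounds hz
  have hre' := abs_le.1 hre
  have him' := abs_le.1 him
  have hzim : 9 / 4 ≤ z.im := by linarith
  have hΓ := XiDerivArg.norm_logDeriv_Gammaℝ_le_disc hT hz
  have hinv1 : ‖z⁻¹‖ ≤ 1 / 2 := by
    rw [norm_inv]
    have hzn : 9 / 4 ≤ ‖z‖ := hzim.trans ((le_abs_self _).trans (Complex.abs_im_le_norm z))
    exact inv_le_of_inv_le₀ (by norm_num) (by norm_num; linarith)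
  have hinv2 : ‖(z - 1)⁻¹‖ ≤ 1 / 2 := by
    rw [norm_inv]
    have h1 : (z - 1).im = z.im := by simp
    have hzn1 : 9 / 4 ≤ ‖z - 1‖ := by
      have := (le_abs_self _).trans (Complex.abs_im_le_norm (z - 1))
      rw [h1] at this
      linarith
    exact inv_le_of_inv_le₀ (by norm_num) (by norm_num; linarith)
  calc ‖z⁻¹ + (z - 1)⁻¹ + logDeriv Gammaℝ z‖
      ≤ ‖z⁻¹‖ + ‖(z - 1)⁻¹‖ + ‖logDeriv Gammaℝ z‖ := norm_add₃_le
    _ ≤ 1 / 2 + 1 / 2 + (Real.log (T + 6) / 2 + 6) := by gcongr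
    _ = 7 + Real.log (T + 6) / 2 := by ring

/-- **`|h′(z)| ≤ 8 M(T)` on the disc `|z − (2+iT)| ≤ 13/8`, `T ≥ 4`** (Cauchy's estimate on the circle of
radius `1/8`, inside the disc `|w − (2+iT)| ≤ 7/4` where `|h| ≤ M(T)`).
[cite: Conrey1983, Lemma 2 proof (p. 52)] -/
theorem norm_deriv_h_le_disc {T : ℝ} (hT : 4 ≤ T) {z : ℂ}
    (hz : z ∈ closedBall ((2 : ℂ) + T * I) (13 / 8)) :
    ‖deriv (fun w ↦ deriv riemannZeta w + (w⁻¹ + (w - 1)⁻¹ + logDeriv Gammaℝ w) * riemannZeta w) z‖ ≤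
      8 * (200 * (T + 4) + 40 * (T + 4) * (7 + Real.log (T + 6) / 2)) := by
  set h : ℂ → ℂ := fun w ↦ deriv riemannZeta w + (w⁻¹ + (w - 1)⁻¹ + logDeriv Gammaℝ w) *
    riemannZeta w with hh
  set M : ℝ := 200 * (T + 4) + 40 * (T + 4) * (7 + Real.log (T + 6) / 2) with hM
  have hsub : closedBall z (1 / 8) ⊆ closedBall ((2 : ℂ) + T * I) (7 / 4) := by
    intro w hw
    rw [mem_closedBall] at hw hz ⊢
    have := dist_triangle w z ((2 : ℂ) + T * I)
    linarith
  have han : ∀ w ∈ closedBall ((2 : ℂ) + T * I) (7 / 4), AnalyticAt ℂ h w := by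
    intro w hw
    obtain ⟨hre, him⟩ := mem_disc_bounds hw
    have hre' := abs_le.1 hre
    have him' := abs_le.1 him
    refine XiDerivArg.analyticAt_h (by linarith) fun h1 ↦ ?_
    have := congrArg Complex.im h1
    simp at this
    linarith
  have hdiff : DifferentiableOn ℂ h (closedBall ((2 : ℂ) + T * I) (7 / 4)) :=
    fun w hw ↦ (han w hw).differentiableAt.differentiableWithinAt
  have hdc : DiffContOnCl ℂ h (ball z (1 / 8)) := hdiff.diffContOnCl_ball hsub
  have hC : ∀ w ∈ sphere z (1 / 8), ‖h w‖ ≤ M := fun w hw ↦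
    XiDerivArg.norm_h_le_disc hT (hsub (sphere_subset_closedBall hw))
  have h := Complex.norm_deriv_le_of_forall_mem_sphere_norm_le (by norm_num : (0 : ℝ) < 1 / 8) hdc hC
  have e : M / (1 / 8 : ℝ) = 8 * M := by ring
  rw [e] at h
  exact h

/-- **`|h₂(z)| ≤ M₂(T) := (15 + log(T+6)/2) · M(T)` on the disc `|z − (2+iT)| ≤ 13/8`, `T ≥ 4`.**
[cite: Conrey1983, Lemma 2 proof (p. 52)] -/
theorem norm_h2_le_disc {T : ℝ} (hT : 4 ≤ T) {z : ℂ} (hz : z ∈ closedBall ((2 : ℂ) + T * I) (13 / 8)) :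
    ‖deriv (fun u ↦ deriv riemannZeta u + (u⁻¹ + (u - 1)⁻¹ + logDeriv Gammaℝ u) * riemannZeta u) z +
        (z⁻¹ + (z - 1)⁻¹ + logDeriv Gammaℝ z) *
          (deriv riemannZeta z + (z⁻¹ + (z - 1)⁻¹ + logDeriv Gammaℝ z) * riemannZeta z)‖ ≤
      (15 + Real.log (T + 6) / 2) * (200 * (T + 4) + 40 * (T + 4) * (7 + Real.log (T + 6) / 2)) := by
  set M : ℝ := 200 * (T + 4) + 40 * (T + 4) * (7 + Real.log (T + 6) / 2) with hM
  have hz' : z ∈ closedBall ((2 : ℂ) + T * I) (7 / 4) := closedBall_subset_closedBall (by norm_num) hz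
  have h1 := norm_deriv_h_le_disc hT hz
  have h2 := XiDerivArg.norm_h_le_disc hT hz'
  have h3 := norm_G_le_disc hT hz'
  have hL0 : 0 ≤ Real.log (T + 6) := Real.log_nonneg (by linarith)
  have hM0 : 0 ≤ M := by rw [hM]; positivity
  have hG0 : 0 ≤ 7 + Real.log (T + 6) / 2 := by linarith
  calc _ ≤ ‖deriv (fun u ↦ deriv riemannZeta u + (u⁻¹ + (u - 1)⁻¹ + logDeriv Gammaℝ u) *
            riemannZeta u) z‖ +
          ‖z⁻¹ + (z - 1)⁻¹ + logDeriv Gammaℝ z‖ *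
            ‖deriv riemannZeta z + (z⁻¹ + (z - 1)⁻¹ + logDeriv Gammaℝ z) * riemannZeta z‖ := by
        rw [← norm_mul]; exact norm_add_le _ _
    _ ≤ 8 * M + (7 + Real.log (T + 6) / 2) * M :=
        add_le_add h1 (mul_le_mul h3 h2 (norm_nonneg _) hG0)
    _ = (15 + Real.log (T + 6) / 2) * M := by ring

/-- **Backlund's lemma for `h₂` on the top edge**: for `T ≥ 4` with `Re ξ′/ξ(2+iT) ≥ 1` and no zero of `ζ`
or `ξ″` on `[½, 2] × {T}`:
`|Im ∫_{1/2}^{2} h₂′/h₂(x+iT) dx| ≤ π (log(4 (T² + 9/4) M₂(T))/log(13/12) + 1)`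
(`|h₂(2+iT)| = |ζ(2+iT)| · |ξ″/ξ′(2+iT)| · |ξ′/ξ(2+iT)| ≥ (1/3) · (3/4)/(T²+9/4)`).
[cite: Conrey1983, Lemma 2 proof (p. 52)] -/
theorem abs_im_integral_logDeriv_h2_le {T : ℝ} (hT : 4 ≤ T)
    (hF : 1 ≤ (deriv riemannXi (2 + T * I) / riemannXi (2 + T * I)).re)
    (hζT : ∀ x ∈ Icc (1 / 2 : ℝ) 2, riemannZeta (x + T * I) ≠ 0)
    (hξT : ∀ x ∈ Icc (1 / 2 : ℝ) 2, deriv (deriv riemannXi) (x + T * I) ≠ 0) :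
    |(∫ x in (1 / 2 : ℝ)..2,
        deriv (fun w ↦
            deriv (fun u ↦ deriv riemannZeta u + (u⁻¹ + (u - 1)⁻¹ + logDeriv Gammaℝ u) *
              riemannZeta u) w +
              (w⁻¹ + (w - 1)⁻¹ + logDeriv Gammaℝ w) *
                (deriv riemannZeta w + (w⁻¹ + (w - 1)⁻¹ + logDeriv Gammaℝ w) * riemannZeta w))
            (x + T * I) /
          (fun w ↦
            deriv (fun u ↦ deriv riemannZeta u + (u⁻¹ + (u - 1)⁻¹ + logDeriv Gammaℝ u) *
              riemannZeta u) w +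
              (w⁻¹ + (w - 1)⁻¹ + logDeriv Gammaℝ w) *
                (deriv riemannZeta w + (w⁻¹ + (w - 1)⁻¹ + logDeriv Gammaℝ w) * riemannZeta w))
            (x + T * I)).im| ≤
      π * (Real.log (4 * (T ^ 2 + 9 / 4) * ((15 + Real.log (T + 6) / 2) *
          (200 * (T + 4) + 40 * (T + 4) * (7 + Real.log (T + 6) / 2)))) / Real.log (13 / 12) + 1) := by
  set h₂ : ℂ → ℂ := fun w ↦
    deriv (fun u ↦ deriv riemannZeta u + (u⁻¹ + (u - 1)⁻¹ + logDeriv Gammaℝ u) * riemannZeta u) w +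
      (w⁻¹ + (w - 1)⁻¹ + logDeriv Gammaℝ w) *
        (deriv riemannZeta w + (w⁻¹ + (w - 1)⁻¹ + logDeriv Gammaℝ w) * riemannZeta w) with hh₂
  set M₂ : ℝ := (15 + Real.log (T + 6) / 2) *
    (200 * (T + 4) + 40 * (T + 4) * (7 + Real.log (T + 6) / 2)) with hM₂
  set q : ℝ := (3 / 4) / (T ^ 2 + 9 / 4) with hq
  have hL0 : 0 ≤ Real.log (T + 6) := Real.log_nonneg (by linarith)
  have hM₂1 : 1 ≤ M₂ := by
    have h1 : (15 : ℝ) ≤ 15 + Real.log (T + 6) / 2 := by linarith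
    have h2 : (1600 : ℝ) ≤ 200 * (T + 4) + 40 * (T + 4) * (7 + Real.log (T + 6) / 2) := by
      nlinarith
    calc (1 : ℝ) ≤ 15 * 1600 := by norm_num
      _ ≤ M₂ := by rw [hM₂]; exact mul_le_mul h1 h2 (by norm_num) (by linarith)
  have hqpos : 0 < q := by rw [hq]; positivity
  have hg : ∀ z ∈ closedBall (((2 : ℝ) : ℂ) + T * I) (13 / 8), AnalyticAt ℂ h₂ z := by
    intro z hz
    simp only [ofReal_ofNat] at hz
    obtain ⟨hre, him⟩ := mem_disc_bounds hz
    have hre' := abs_le.1 hre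
    have him' := abs_le.1 him
    refine analyticAt_h2 (by linarith) fun h1 ↦ ?_
    have := congrArg Complex.im h1
    simp at this
    linarith
  have hgM : ∀ z ∈ closedBall (((2 : ℝ) : ℂ) + T * I) (13 / 8), ‖h₂ z‖ ≤ M₂ := by
    intro z hz
    simp only [ofReal_ofNat] at hz
    exact norm_h2_le_disc hT hz
  have hcenter : h₂ ((2 : ℝ) + T * I) = riemannZeta (2 + T * I) *
      (deriv (deriv riemannXi) (2 + T * I) / riemannXi (2 + T * I)) := by
    simp only [ofReal_ofNat, hh₂]
    exact h2_eq_zeta_mul (by simp) (fun h1 ↦ by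
      have := congrArg Complex.re h1; norm_num at this) (riemannZeta_two_add_ne_zero T)
  have hξ2 : deriv riemannXi (2 + T * I) ≠ 0 := deriv_riemannXi_ne_zero_of_one_le_re (by simp)
  have hnorm : q / 3 ≤ ‖h₂ ((2 : ℝ) + T * I)‖ := by
    have h1 := one_third_le_norm_riemannZeta_two_add T
    have hsplit : deriv (deriv riemannXi) (2 + T * I) / riemannXi (2 + T * I) =
        (deriv (deriv riemannXi) (2 + T * I) / deriv riemannXi (2 + T * I)) *
          (deriv riemannXi (2 + T * I) / riemannXi (2 + T * I)) := by
      field_simp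
    have h2 : q ≤ ‖deriv (deriv riemannXi) (2 + T * I) / deriv riemannXi (2 + T * I)‖ :=
      (re_deriv2_div_deriv_two_add_ge T).trans (re_le_norm _)
    have h3 : 1 ≤ ‖deriv riemannXi (2 + T * I) / riemannXi (2 + T * I)‖ := hF.trans (re_le_norm _)
    rw [hcenter, hsplit, norm_mul, norm_mul]
    have hAB : q ≤ ‖deriv (deriv riemannXi) (2 + T * I) / deriv riemannXi (2 + T * I)‖ *
        ‖deriv riemannXi (2 + T * I) / riemannXi (2 + T * I)‖ := by
      have := mul_le_mul h2 h3 zero_le_one (norm_nonneg _)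
      rwa [mul_one] at this
    have h5 := mul_le_mul h1 hAB hqpos.le (norm_nonneg _)
    linarith
  have hc : h₂ ((2 : ℝ) + T * I) ≠ 0 := by
    intro h0; rw [h0, norm_zero] at hnorm; linarith
  have h0 : ∀ x ∈ Icc (1 / 2 : ℝ) 2, h₂ (x + T * I) ≠ 0 := by
    intro x hx h0'
    have hx1 : (x : ℂ) + T * I ≠ 1 := fun h1 ↦ by
      have := congrArg Complex.im h1; simp at this; linarith
    have hre : 0 < ((x : ℂ) + T * I).re := by simp; linarith [hx.1]
    have e := h2_eq_zeta_mul hre hx1 (hζT x hx)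
    simp only [hh₂] at h0'
    rw [h0'] at e
    have hξ : riemannXi (x + T * I) ≠ 0 := fun h0'' ↦
      hζT x hx ((riemannXi_eq_zero_iff_holds _).1 h0'').1
    rcases mul_eq_zero.1 e.symm with h' | h'
    · exact hζT x hx h'
    · exact div_ne_zero (hξT x hx) hξ h'
  have hB := Literature.Analysis.Complex.abs_im_integral_logDeriv_le_backlund (g := h₂) (c := 2) (y := T)
    (r := 3 / 2) (R := 13 / 8) (M := M₂) (a := 1 / 2) (b := 2) (by norm_num) (by norm_num) hM₂1 hg hgM hc
    (by norm_num) (by norm_num) (by norm_num) h0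
  refine hB.trans ?_
  have h1312 : (13 : ℝ) / 8 / (3 / 2) = 13 / 12 := by norm_num
  rw [h1312]
  have hlog : 0 < Real.log (13 / 12) := Real.log_pos (by norm_num)
  have hpos : 0 < ‖h₂ ((2 : ℝ) + T * I)‖ := by linarith
  have h1 : Real.log (M₂ / ‖h₂ ((2 : ℝ) + T * I)‖) ≤ Real.log (4 * (T ^ 2 + 9 / 4) * M₂) := by
    apply Real.log_le_log (div_pos (by linarith) hpos)
    rw [div_le_iff₀ hpos]
    have e : 4 * (T ^ 2 + 9 / 4) * M₂ * (q / 3) = M₂ := by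
      rw [hq]; field_simp
    calc M₂ = 4 * (T ^ 2 + 9 / 4) * M₂ * (q / 3) := e.symm
      _ ≤ 4 * (T ^ 2 + 9 / 4) * M₂ * ‖h₂ ((2 : ℝ) + T * I)‖ :=
          mul_le_mul_of_nonneg_left hnorm (by positivity)
  have := div_le_div_of_nonneg_right h1 hlog.le
  nlinarith [Real.pi_pos]

/-! ## §7. The horizontal edge is `O(log T)` -/

/-- **The horizontal edge**: for `T ≥ 4` with `Re ξ′/ξ(2+iT) ≥ 1` and no zero of `ζ` or `ξ″` on
`[½, 2] × {T}`, with `F₂ = ξ‴/ξ″`, `F = ξ′/ξ`,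
`|Im ∫_{1/2}^{2} F₂(x+iT) dx − Im ∫_{1/2}^{2} F(x+iT) dx| ≤ π (log(4(T²+9/4) M₂(T))/log(13/12) + 1) +
π (log(120(T+4))/log(7/6) + 1)`. [cite: Conrey1983, Lemma 2 proof (p. 52)] -/
theorem abs_horizontal_sub_le₂ {T : ℝ} (hT : 4 ≤ T)
    (hF : 1 ≤ (deriv riemannXi (2 + T * I) / riemannXi (2 + T * I)).re)
    (hζT : ∀ x ∈ Icc (1 / 2 : ℝ) 2, riemannZeta (x + T * I) ≠ 0)
    (hξT : ∀ x ∈ Icc (1 / 2 : ℝ) 2, deriv (deriv riemannXi) (x + T * I) ≠ 0) :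
    |(∫ x in (1 / 2 : ℝ)..2, deriv (deriv (deriv riemannXi)) (x + T * I) /
        deriv (deriv riemannXi) (x + T * I)).im -
      (∫ x in (1 / 2 : ℝ)..2, deriv riemannXi (x + T * I) / riemannXi (x + T * I)).im| ≤
      π * (Real.log (4 * (T ^ 2 + 9 / 4) * ((15 + Real.log (T + 6) / 2) *
          (200 * (T + 4) + 40 * (T + 4) * (7 + Real.log (T + 6) / 2)))) / Real.log (13 / 12) + 1) +
        π * (Real.log (120 * (T + 4)) / Real.log (7 / 6) + 1) := by
  set h₂ : ℂ → ℂ := fun w ↦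
            deriv (fun u ↦ deriv riemannZeta u + (u⁻¹ + (u - 1)⁻¹ + logDeriv Gammaℝ u) *
              riemannZeta u) w +
              (w⁻¹ + (w - 1)⁻¹ + logDeriv Gammaℝ w) *
                (deriv riemannZeta w + (w⁻¹ + (w - 1)⁻¹ + logDeriv Gammaℝ w) * riemannZeta w) with hh₂
  set F₂ : ℂ → ℂ := fun z ↦ deriv (deriv (deriv riemannXi)) z / deriv (deriv riemannXi) z with hF₂
  set F : ℂ → ℂ := fun z ↦ deriv riemannXi z / riemannXi z with hF'
  set Lh : ℂ → ℂ := fun z ↦ deriv h₂ z / h₂ z with hLh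
  set Lζ : ℂ → ℂ := fun z ↦ deriv riemannZeta z / riemannZeta z with hLζ
  have hx1 : ∀ x : ℝ, (x : ℂ) + T * I ≠ 1 := fun x h1 ↦ by
    have := congrArg Complex.im h1; simp at this; linarith
  have hxre : ∀ x ∈ Icc (1 / 2 : ℝ) 2, 0 < ((x : ℂ) + T * I).re := fun x hx ↦ by simp; linarith [hx.1]
  have hξ : ∀ x ∈ Icc (1 / 2 : ℝ) 2, riemannXi (x + T * I) ≠ 0 := fun x hx h0 ↦
    hζT x hx ((riemannXi_eq_zero_iff_holds _).1 h0).1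
  have hpt : ∀ x ∈ Icc (1 / 2 : ℝ) 2, F₂ (x + T * I) - F (x + T * I) = Lh (x + T * I) - Lζ (x + T * I) :=
    fun x hx ↦ logDeriv_deriv2_sub_logDeriv_eq_h2 (hxre x hx) (hx1 x) (hζT x hx) (hξT x hx)
  have hh0 : ∀ x ∈ Icc (1 / 2 : ℝ) 2, h₂ (x + T * I) ≠ 0 := by
    intro x hx h0
    have e := h2_eq_zeta_mul (hxre x hx) (hx1 x) (hζT x hx)
    simp only [hh₂] at h0
    rw [h0] at e
    rcases mul_eq_zero.1 e.symm with h' | h'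
    · exact hζT x hx h'
    · exact div_ne_zero (hξT x hx) (hξ x hx) h'
  have i1 : IntervalIntegrable (fun x : ℝ ↦ F₂ (x + T * I)) volume (1 / 2) 2 :=
    Literature.Analysis.Complex.intervalIntegrable_of_continuousAt_horizontal (F := F₂) T (by norm_num)
      fun x hx ↦ continuousAt_logDeriv_deriv2 (hξT x hx)
  have i2 : IntervalIntegrable (fun x : ℝ ↦ F (x + T * I)) volume (1 / 2) 2 :=
    Literature.Analysis.Complex.intervalIntegrable_of_continuousAt_horizontal (F := F) T (by norm_num)
      fun x hx ↦ continuousAt_logDeriv_riemannXi (hξ x hx)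
  have i3 : IntervalIntegrable (fun x : ℝ ↦ Lh (x + T * I)) volume (1 / 2) 2 :=
    Literature.Analysis.Complex.intervalIntegrable_of_continuousAt_horizontal (F := Lh) T (by norm_num)
      fun x hx ↦ by
        have ha := analyticAt_h2 (hxre x hx) (hx1 x)
        exact ha.deriv.continuousAt.div ha.continuousAt (hh0 x hx)
  have i4 : IntervalIntegrable (fun x : ℝ ↦ Lζ (x + T * I)) volume (1 / 2) 2 :=
    Literature.Analysis.Complex.intervalIntegrable_of_continuousAt_horizontal (F := Lζ) T (by norm_num)
      fun x hx ↦ continuousAt_logDeriv_riemannZeta (hx1 x) (hζT x hx)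
  have hint : (∫ x in (1 / 2 : ℝ)..2, F₂ (x + T * I)) - (∫ x in (1 / 2 : ℝ)..2, F (x + T * I)) =
      (∫ x in (1 / 2 : ℝ)..2, Lh (x + T * I)) - ∫ x in (1 / 2 : ℝ)..2, Lζ (x + T * I) := by
    rw [← intervalIntegral.integral_sub i1 i2, ← intervalIntegral.integral_sub i3 i4]
    refine intervalIntegral.integral_congr fun x hx ↦ ?_
    rw [uIcc_of_le (by norm_num)] at hx
    exact hpt x hx
  have hB1 := abs_im_integral_logDeriv_h2_le hT hF hζT hξT
  have hB2 := abs_im_integral_logDeriv_riemannZeta_horizontal_le (T := T) (by linarith) hζT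
  have key : (∫ x in (1 / 2 : ℝ)..2, F₂ (x + T * I)).im - (∫ x in (1 / 2 : ℝ)..2, F (x + T * I)).im =
      (∫ x in (1 / 2 : ℝ)..2, Lh (x + T * I)).im - (∫ x in (1 / 2 : ℝ)..2, Lζ (x + T * I)).im := by
    rw [← sub_im, hint, sub_im]
  show |(∫ x in (1 / 2 : ℝ)..2, F₂ (x + T * I)).im - (∫ x in (1 / 2 : ℝ)..2, F (x + T * I)).im| ≤ _
  rw [key]
  exact (abs_sub _ _).trans (add_le_add hB1 hB2)

/-! ## §8. `|N^{(2)}(T) − N(T)| ≪ log T` off the ordinates, and for all large `T` -/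

/-- **Conrey's Lemma 2 (`m = 2`), explicit form off the ordinates.** For `T ≥ 4` with
`Re ξ′/ξ(2+iT) ≥ 1`, `T` not the ordinate of a zero of `ζ` nor of `ξ″`:
`|N^{(2)}(T) − N(T)| ≤ 4 + log(4(T²+9/4)M₂(T))/log(13/12) + log(120(T+4))/log(7/6)`.
[cite: Conrey1983, Lemma 2 (p. 52)] -/
theorem abs_sub_le_of_not_ordinate₂ {T : ℝ} (hT : 4 ≤ T)
    (hF : 1 ≤ (deriv riemannXi (2 + T * I) / riemannXi (2 + T * I)).re)
    (hζ : ∀ ρ : ℂ, riemannZeta ρ = 0 → ρ.im ≠ T)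
    (hξ' : ∀ ρ : ℂ, deriv (deriv riemannXi) ρ = 0 → ρ.im ≠ T) :
    |(xiDerivZeroCount 2 T : ℝ) - zetaZeroCount T| ≤
      4 + Real.log (4 * (T ^ 2 + 9 / 4) * ((15 + Real.log (T + 6) / 2) *
          (200 * (T + 4) + 40 * (T + 4) * (7 + Real.log (T + 6) / 2)))) / Real.log (13 / 12) +
        Real.log (120 * (T + 4)) / Real.log (7 / 6) := by
  have hT0 : 0 < T := by linarith
  have hq2 := quarter_path_eq_xiDeriv2 hT0 hξ'
  have hq := XiDerivArg.quarter_path_eq_xi hT0 hζ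
  have hv1 := XiDerivArg.abs_vertical_sub_le hT0.le
  have hv2 := abs_vertical_sub_le₂ hT0.le
  have hh := abs_horizontal_sub_le₂ hT hF (fun x _ h0 ↦ hζ _ h0 (by simp))
    (fun x _ h0 ↦ hξ' _ h0 (by simp))
  set A₂ : ℝ := ∫ y in (0 : ℝ)..T, (deriv (deriv (deriv riemannXi)) (2 + y * I) /
    deriv (deriv riemannXi) (2 + y * I)).re
  set B₂ : ℝ := (∫ x in (1 / 2 : ℝ)..2,
    deriv (deriv (deriv riemannXi)) (x + T * I) / deriv (deriv riemannXi) (x + T * I)).im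
  set A₁ : ℝ := ∫ y in (0 : ℝ)..T, (deriv (deriv riemannXi) (2 + y * I) / deriv riemannXi (2 + y * I)).re
  set A : ℝ := ∫ y in (0 : ℝ)..T, (deriv riemannXi (2 + y * I) / riemannXi (2 + y * I)).re
  set B : ℝ := (∫ x in (1 / 2 : ℝ)..2, deriv riemannXi (x + T * I) / riemannXi (x + T * I)).im
  set L : ℝ := Real.log (4 * (T ^ 2 + 9 / 4) * ((15 + Real.log (T + 6) / 2) *
    (200 * (T + 4) + 40 * (T + 4) * (7 + Real.log (T + 6) / 2))))
  set L' : ℝ := Real.log (120 * (T + 4))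
  set l : ℝ := Real.log (13 / 12)
  set l' : ℝ := Real.log (7 / 6)
  have hπ := Real.pi_pos
  -- `π (N₂ − N) = (A₂ − A) − (B₂ − B)`
  have hid : π * ((xiDerivZeroCount 2 T : ℝ) - zetaZeroCount T) = (A₂ - A) - (B₂ - B) := by
    linarith
  have hv1' := abs_le.1 hv1
  have hv2' := abs_le.1 hv2
  have hh' := abs_le.1 hh
  rw [abs_le]
  constructor
  · have key : π * (-(4 + L / l + L' / l')) ≤ π * ((xiDerivZeroCount 2 T : ℝ) - zetaZeroCount T) := by
      rw [hid]
      have e : π * (-(4 + L / l + L' / l')) =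
          -(2 * π) - (π * (L / l + 1) + π * (L' / l' + 1)) := by ring
      rw [e]
      linarith
    exact le_of_mul_le_mul_left key hπ
  · have key : π * ((xiDerivZeroCount 2 T : ℝ) - zetaZeroCount T) ≤ π * (4 + L / l + L' / l') := by
      rw [hid]
      have e : π * (4 + L / l + L' / l') = 2 * π + (π * (L / l + 1) + π * (L' / l' + 1)) := by
        ring
      rw [e]
      linarith
    exact le_of_mul_le_mul_left key hπ

/-- The explicit bound is at most `150 + 72 log(T + 6)` for `T ≥ 4`. [folklore] -/
private theorem explicit_bound_le₂ {T : ℝ} (hT : 4 ≤ T) :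
    4 + Real.log (4 * (T ^ 2 + 9 / 4) * ((15 + Real.log (T + 6) / 2) *
          (200 * (T + 4) + 40 * (T + 4) * (7 + Real.log (T + 6) / 2)))) / Real.log (13 / 12) +
        Real.log (120 * (T + 4)) / Real.log (7 / 6) ≤ 150 + 72 * Real.log (T + 6) := by
  set L6 : ℝ := Real.log (T + 6) with hL6
  have hL6₀ : 0 ≤ L6 := Real.log_nonneg (by linarith)
  have hL6' : L6 ≤ T + 5 := (Real.log_le_sub_one_of_pos (by linarith)).trans (by linarith)
  have he1 : (2.7 : ℝ) < Real.exp 1 := lt_trans (by norm_num) Real.exp_one_gt_d9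
  -- the big logarithm: `X := 4 (T²+9/4) (15 + L6/2) M(T) ≤ 544 (T+6)^5`
  have hM : 200 * (T + 4) + 40 * (T + 4) * (7 + L6 / 2) ≤ 68 * (T + 6) ^ 2 := by nlinarith
  have h15 : 15 + L6 / 2 ≤ 2 * (T + 6) := by linarith
  have hT2 : T ^ 2 + 9 / 4 ≤ (T + 6) ^ 2 := by nlinarith
  have hXle : 4 * (T ^ 2 + 9 / 4) * ((15 + L6 / 2) * (200 * (T + 4) + 40 * (T + 4) * (7 + L6 / 2))) ≤
      544 * (T + 6) ^ 5 := by
    have h1 : (15 + L6 / 2) * (200 * (T + 4) + 40 * (T + 4) * (7 + L6 / 2)) ≤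
        2 * (T + 6) * (68 * (T + 6) ^ 2) :=
      mul_le_mul h15 hM (by positivity) (by positivity)
    calc 4 * (T ^ 2 + 9 / 4) * ((15 + L6 / 2) * (200 * (T + 4) + 40 * (T + 4) * (7 + L6 / 2)))
        ≤ 4 * (T + 6) ^ 2 * (2 * (T + 6) * (68 * (T + 6) ^ 2)) :=
          mul_le_mul (by linarith) h1 (by positivity) (by positivity)
      _ = 544 * (T + 6) ^ 5 := by ring
  have hXpos : 0 < 4 * (T ^ 2 + 9 / 4) * ((15 + L6 / 2) *
      (200 * (T + 4) + 40 * (T + 4) * (7 + L6 / 2))) := by positivity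
  have h544 : Real.log 544 ≤ 7 := by
    rw [Real.log_le_iff_le_exp (by norm_num)]
    have h7 : Real.exp 7 = Real.exp 1 ^ 7 := by rw [← Real.exp_nat_mul]; norm_num
    rw [h7]
    have := pow_le_pow_left₀ (by norm_num) he1.le 7
    nlinarith
  have h120 : Real.log 120 ≤ 5 := by
    rw [Real.log_le_iff_le_exp (by norm_num)]
    have h5 : Real.exp 5 = Real.exp 1 ^ 5 := by rw [← Real.exp_nat_mul]; norm_num
    rw [h5]
    have := pow_le_pow_left₀ (by norm_num) he1.le 5
    nlinarith
  have h1 : Real.log (4 * (T ^ 2 + 9 / 4) * ((15 + L6 / 2) *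
      (200 * (T + 4) + 40 * (T + 4) * (7 + L6 / 2)))) ≤ 7 + 5 * L6 := by
    have hR : Real.log (544 * (T + 6) ^ 5) = Real.log 544 + 5 * L6 := by
      rw [Real.log_mul (by norm_num) (by positivity), Real.log_pow, hL6]
      push_cast
      ring
    have := Real.log_le_log hXpos hXle
    rw [hR] at this
    linarith
  have h1₀ : 0 ≤ Real.log (4 * (T ^ 2 + 9 / 4) * ((15 + L6 / 2) *
      (200 * (T + 4) + 40 * (T + 4) * (7 + L6 / 2)))) := by
    apply Real.log_nonneg
    have ha : (1 : ℝ) ≤ 4 * (T ^ 2 + 9 / 4) := by nlinarith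
    have hb1 : (15 : ℝ) ≤ 15 + L6 / 2 := by linarith
    have hb2 : (1600 : ℝ) ≤ 200 * (T + 4) + 40 * (T + 4) * (7 + L6 / 2) := by nlinarith
    have hb : (1 : ℝ) ≤ (15 + L6 / 2) * (200 * (T + 4) + 40 * (T + 4) * (7 + L6 / 2)) :=
      calc (1 : ℝ) ≤ 15 * 1600 := by norm_num
        _ ≤ _ := mul_le_mul hb1 hb2 (by norm_num) (by linarith)
    calc (1 : ℝ) = 1 * 1 := by ring
      _ ≤ _ := mul_le_mul ha hb zero_le_one (by linarith)
  have h2 : Real.log (120 * (T + 4)) ≤ 5 + L6 := by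
    rw [Real.log_mul (by norm_num) (by positivity)]
    have := Real.log_le_log (by positivity : (0 : ℝ) < T + 4) (show T + 4 ≤ T + 6 by linarith)
    rw [← hL6] at this
    linarith
  have h2₀ : 0 ≤ Real.log (120 * (T + 4)) := Real.log_nonneg (by linarith)
  have hl76 : 1 / 7 ≤ Real.log (7 / 6) := by
    have := Real.one_sub_inv_le_log_of_pos (show (0 : ℝ) < 7 / 6 by norm_num)
    norm_num at this ⊢
    linarith
  have hl1312 : 1 / 13 ≤ Real.log (13 / 12) := by
    have := Real.one_sub_inv_le_log_of_pos (show (0 : ℝ) < 13 / 12 by norm_num)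
    norm_num at this ⊢
    linarith
  have hl76pos : 0 < Real.log (7 / 6) := by linarith
  have hl1312pos : 0 < Real.log (13 / 12) := by linarith
  have hdiv1 : Real.log (4 * (T ^ 2 + 9 / 4) * ((15 + L6 / 2) *
      (200 * (T + 4) + 40 * (T + 4) * (7 + L6 / 2)))) / Real.log (13 / 12) ≤ 13 * (7 + 5 * L6) := by
    rw [div_le_iff₀ hl1312pos]
    nlinarith
  have hdiv2 : Real.log (120 * (T + 4)) / Real.log (7 / 6) ≤ 7 * (5 + L6) := by
    rw [div_le_iff₀ hl76pos]
    nlinarith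
  linarith

/-- **Conrey 1983, Lemma 2 for `m = 2` (counting part): `N^{(2)}(T) = N(T) + O(log T)`, explicitly
`|N^{(2)}(T) − N(T)| ≤ 150 + 72 log(T + 7)` for all `T ≥ T₀`.** Off the ordinates this is
`abs_sub_le_of_not_ordinate₂`; a general `T` is moved up to a nearby `T′ ∈ (T, T+1)` past no ordinate
of `ζ` or `ξ″`, where both counting functions take the same values. [cite: Conrey1983, Lemma 2 (p. 52)] -/
theorem exists_abs_xiDerivZeroCount_two_sub_zetaZeroCount_le :
    ∃ T₀ : ℝ, 4 ≤ T₀ ∧ ∀ T : ℝ, T₀ ≤ T →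
      |(xiDerivZeroCount 2 T : ℝ) - zetaZeroCount T| ≤ 150 + 72 * Real.log (T + 7) := by
  obtain ⟨T₁, hT₁, hF⟩ := XiDerivArg.exists_re_logDeriv_riemannXi_two_add_ge
  refine ⟨T₁, hT₁, fun T hT ↦ ?_⟩
  classical
  set Zζ : Set ℂ := {ρ ∈ zetaZeroBox 0 (T + 1) | T < ρ.im} with hZζ
  set Zξ : Set ℂ := {ρ ∈ xiDerivZeroBox 2 (T + 1) | T < ρ.im} with hZξ
  have hfinζ : Zζ.Finite := (zetaZeroBox_finite 0 (T + 1)).subset (sep_subset _ _)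
  have hfinξ : Zξ.Finite := (XiDerivCritical.xiDerivZeroBox_finite 2 (T + 1)).subset (sep_subset _ _)
  set Fs : Finset ℝ := insert (T + 1)
    ((hfinζ.toFinset.image Complex.im) ∪ (hfinξ.toFinset.image Complex.im)) with hFs
  have hne : Fs.Nonempty := Finset.insert_nonempty _ _
  set m : ℝ := Fs.min' hne with hm
  have hmle : m ≤ T + 1 := Finset.min'_le _ _ (Finset.mem_insert_self _ _)
  have hmgt : T < m := by
    have hmem := Finset.min'_mem Fs hne
    rw [← hm] at hmem
    rcases Finset.mem_insert.1 hmem with h | h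
    · linarith
    · rcases Finset.mem_union.1 h with h | h
      · obtain ⟨ρ, hρ, hρm⟩ := Finset.mem_image.1 h
        rw [Set.Finite.mem_toFinset] at hρ
        rw [← hρm]; exact hρ.2
      · obtain ⟨ρ, hρ, hρm⟩ := Finset.mem_image.1 h
        rw [Set.Finite.mem_toFinset] at hρ
        rw [← hρm]; exact hρ.2
  set T' : ℝ := (T + m) / 2 with hT'
  have hTT' : T < T' := by rw [hT']; linarith
  have hT'1 : T' < T + 1 := by rw [hT']; linarith
  have hT'm : T' < m := by rw [hT']; linarith
  have hnoζ : ∀ ρ : ℂ, riemannZeta ρ = 0 → ¬(T < ρ.im ∧ ρ.im ≤ T') := by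
    rintro ρ hζ0 ⟨h1, h2⟩
    have him : ρ.im ≠ 0 := by intro h0; rw [h0] at h1; linarith
    have hst := re_mem_Ioo_of_riemannZeta_eq_zero_of_im_ne_zero hζ0 him
    have hρZ : ρ ∈ Zζ := ⟨⟨hζ0, hst.1.le, hst.2.le, by linarith, by linarith⟩, h1⟩
    have hρF : ρ.im ∈ Fs := Finset.mem_insert_of_mem (Finset.mem_union_left _
      (Finset.mem_image.2 ⟨ρ, (Set.Finite.mem_toFinset hfinζ).2 hρZ, rfl⟩))
    have := Finset.min'_le Fs _ hρF
    rw [← hm] at this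
    linarith
  have hnoξ : ∀ ρ : ℂ, deriv (deriv riemannXi) ρ = 0 → ¬(T < ρ.im ∧ ρ.im ≤ T') := by
    rintro ρ h0 ⟨h1, h2⟩
    have hρZ : ρ ∈ Zξ := ⟨⟨by rw [iteratedDeriv_two_eq]; exact h0, by linarith, by linarith⟩, h1⟩
    have hρF : ρ.im ∈ Fs := Finset.mem_insert_of_mem (Finset.mem_union_right _
      (Finset.mem_image.2 ⟨ρ, (Set.Finite.mem_toFinset hfinξ).2 hρZ, rfl⟩))
    have := Finset.min'_le Fs _ hρF
    rw [← hm] at this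
    linarith
  have hζ' : ∀ ρ : ℂ, riemannZeta ρ = 0 → ρ.im ≠ T' := fun ρ h0 he ↦
    hnoζ ρ h0 ⟨by rw [he]; exact hTT', he.le⟩
  have hξ'' : ∀ ρ : ℂ, deriv (deriv riemannXi) ρ = 0 → ρ.im ≠ T' := fun ρ h0 he ↦
    hnoξ ρ h0 ⟨by rw [he]; exact hTT', he.le⟩
  have hN : zetaZeroCount T' = zetaZeroCount T := zetaZeroCount_eq_of_no_ordinate hTT'.le hnoζ
  have hN₂ : xiDerivZeroCount 2 T' = xiDerivZeroCount 2 T := by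
    have hbox : xiDerivZeroBox 2 T' = xiDerivZeroBox 2 T := by
      ext ρ
      simp only [xiDerivZeroBox, mem_setOf_eq, iteratedDeriv_two_eq]
      constructor
      · rintro ⟨h0, h1, h2⟩
        exact ⟨h0, h1, le_of_not_gt fun hlt ↦ hnoξ ρ h0 ⟨hlt, h2⟩⟩
      · rintro ⟨h0, h1, h2⟩
        exact ⟨h0, h1, h2.trans hTT'.le⟩
    unfold xiDerivZeroCount
    rw [hbox]
  have hT'4 : 4 ≤ T' := by linarith
  have hb := abs_sub_le_of_not_ordinate₂ hT'4 (hF T' (by linarith)) hζ' hξ''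
  rw [hN, hN₂] at hb
  refine hb.trans ((explicit_bound_le₂ hT'4).trans ?_)
  have := Real.log_le_log (by linarith : (0 : ℝ) < T' + 6) (show T' + 6 ≤ T + 7 by linarith)
  linarith

end XiDeriv2Arg

/-! ## §9. The theorems -/

/-- **Conrey 1983, Lemma 2 (`m = 2`): `N^{(2)}(T) − N(T) = O(log T)`.** There are `C` and `T₀` with
`|N^{(2)}(T) − N(T)| ≤ C log T` for all `T ≥ T₀`, where `N^{(2)}(T) = xiDerivZeroCount 2 T` counts the
zeros of `ξ″` with `0 < Im s ≤ T` and `N(T) = zetaZeroCount T` those of `ζ` (both with multiplicity).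
PROVED by Backlund's argument (argument principle for `ξ″` and `ξ` on `[−1,2] × [−T,T]`, Jensen's formula
on the top edge, `Re ξ′/ξ > 0` and `Re ξ″/ξ′ > 0` on `Re s = 2`). [cite: Conrey1983, Lemma 2 (p. 52)] -/
theorem exists_abs_xiDerivZeroCount_two_sub_zetaZeroCount_le_log :
    ∃ C T₀ : ℝ, 0 < T₀ ∧ ∀ T : ℝ, T₀ ≤ T →
      |(xiDerivZeroCount 2 T : ℝ) - zetaZeroCount T| ≤ C * Real.log T := by
  obtain ⟨T₀, hT₀, h⟩ := XiDeriv2Arg.exists_abs_xiDerivZeroCount_two_sub_zetaZeroCount_le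
  refine ⟨294, T₀, by linarith, fun T hT ↦ (h T hT).trans ?_⟩
  have hT4 : 4 ≤ T := hT₀.trans hT
  have hlogT : 1 ≤ Real.log T := by
    rw [Real.le_log_iff_exp_le (by linarith)]
    have := Real.exp_one_lt_d9
    linarith
  have h7 : Real.log (T + 7) ≤ 2 * Real.log T := by
    have hsq : T + 7 ≤ T ^ 2 := by nlinarith
    calc Real.log (T + 7) ≤ Real.log (T ^ 2) := Real.log_le_log (by linarith) hsq
      _ = 2 * Real.log T := by rw [Real.log_pow]; push_cast; ring
  linarith

/-- **Conrey 1983, Lemma 2 (`m = 2`), printed form**: `N^{(2)}(T) = (T/2π) log(T/2π) − T/2π + O(log T)`.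
[cite: Conrey1983, Lemma 2 (p. 52)] -/
theorem xiDerivZeroCount_two_riemann_von_mangoldt :
    (fun T : ℝ ↦ (xiDerivZeroCount 2 T : ℝ) - (T / (2 * π) * Real.log (T / (2 * π)) - T / (2 * π)))
      =O[atTop] Real.log := by
  obtain ⟨C, T₀, hT₀, h⟩ := exists_abs_xiDerivZeroCount_two_sub_zetaZeroCount_le_log
  have h1 : (fun T : ℝ ↦ (xiDerivZeroCount 2 T : ℝ) - zetaZeroCount T) =O[atTop] Real.log := by
    refine Asymptotics.IsBigO.of_bound C ?_
    filter_upwards [eventually_ge_atTop T₀, eventually_ge_atTop (1 : ℝ)] with T hT hT1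
    rw [Real.norm_eq_abs, Real.norm_eq_abs, abs_of_nonneg (Real.log_nonneg hT1)]
    exact h T hT
  have h2 : (fun T : ℝ ↦ (zetaZeroCount T : ℝ) - (T / (2 * π) * Real.log (T / (2 * π)) - T / (2 * π)))
      =O[atTop] Real.log := riemann_von_mangoldt_holds
  refine (h1.add h2).congr_left fun T ↦ ?_
  ring

/-- **At least `(2/3 − ε) N^{(2)}(T)` of the zeros of `ξ″` up to height `T` are on the critical line**, for
every `ε > 0` and all large `T` (`m`-fold Rolle + [AF26] Theorem A (i):
`(2/3 − ε/2) N(T) ≤ N^{(2)}₀(T)`; Lemma 2: `N^{(2)}(T) ≤ N(T) + C log T`).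
[cite: Conrey1983, §1 (p. 49) and Lemma 2 (p. 52)] [cite: AlpogeFurman2026, Theorem A (i) and Remark 7.1] -/
theorem eventually_two_thirds_mul_xiDerivZeroCount_two_le (ε : ℝ) (hε : 0 < ε) :
    ∀ᶠ T : ℝ in atTop, (2 / 3 - ε) * (xiDerivZeroCount 2 T : ℝ) ≤ xiDerivCriticalZeroCount 2 T := by
  rcases le_or_gt (2 / 3 : ℝ) ε with hbig | hsmall
  · filter_upwards with T
    have h0 : (0 : ℝ) ≤ xiDerivCriticalZeroCount 2 T := Nat.cast_nonneg _
    have h1 : (0 : ℝ) ≤ xiDerivZeroCount 2 T := Nat.cast_nonneg _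
    nlinarith
  obtain ⟨C, T₀, hT₀, hC⟩ := exists_abs_xiDerivZeroCount_two_sub_zetaZeroCount_le_log
  have hA := eventually_two_thirds_mul_zetaZeroCount_le_xiDerivCriticalZeroCount_higher 2 (ε / 2)
    (by positivity)
  have hmain := AlpogeFurman2026.eventually_zetaZeroCount_near_main (1 / 2) (by norm_num)
  filter_upwards [hA, hmain, eventually_ge_atTop T₀, eventually_gt_atTop (1 : ℝ),
    eventually_ge_atTop (16 * Real.pi * |C| / (3 * ε))] with T hAT hN hT hT1 hTC
  have hπ := Real.pi_pos
  have hL : 0 < Real.log T := Real.log_pos hT1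
  have hb := hC T hT
  have hN₂le : (xiDerivZeroCount 2 T : ℝ) ≤ zetaZeroCount T + |C| * Real.log T := by
    have := (abs_le.1 (hb.trans (mul_le_mul_of_nonneg_right (le_abs_self C) hL.le))).2
    linarith
  have hNlow : (1 - 1 / 2) * (T / (2 * Real.pi) * Real.log T) ≤ zetaZeroCount T := hN.1
  have hClog : 2 / 3 * (|C| * Real.log T) ≤ ε / 2 * (zetaZeroCount T : ℝ) := by
    have h1 : 2 / 3 * (|C| * Real.log T) ≤ ε / 2 * ((1 - 1 / 2) * (T / (2 * Real.pi) * Real.log T)) := by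
      rw [div_le_iff₀ (by positivity)] at hTC
      have : 2 / 3 * |C| ≤ ε / 2 * ((1 - 1 / 2) * (T / (2 * Real.pi))) := by
        rw [show ε / 2 * ((1 - 1 / 2) * (T / (2 * Real.pi))) = ε * T / (8 * Real.pi) by ring,
          le_div_iff₀ (by positivity)]
        nlinarith
      nlinarith
    exact h1.trans (mul_le_mul_of_nonneg_left hNlow (by positivity))
  have hc : 0 ≤ 2 / 3 - ε := by linarith
  calc (2 / 3 - ε) * (xiDerivZeroCount 2 T : ℝ)
      ≤ (2 / 3 - ε) * (zetaZeroCount T + |C| * Real.log T) := mul_le_mul_of_nonneg_left hN₂le hc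
    _ ≤ (2 / 3 - ε) * zetaZeroCount T + 2 / 3 * (|C| * Real.log T) := by
        nlinarith [mul_nonneg (abs_nonneg C) hL.le]
    _ ≤ (2 / 3 - ε / 2) * zetaZeroCount T := by linarith
    _ ≤ xiDerivCriticalZeroCount 2 T := hAT

/-- **Unconditionally, `κ′₂ ≥ 2/3`: at least two thirds of the zeros of `ξ″` are on the critical line**
(`xiDerivCriticalLineProportion 2 = liminf_T N^{(2)}₀(T)/N^{(2)}(T) ≥ 2/3`). The literature has
`κ′₂ ≥ 0.9584` (Conrey 1983, Corollary p. 50, by Levinson's method; NOT proved in the tree).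
[cite: Conrey1983, §1 (p. 49), Corollary (p. 50)] [cite: AlpogeFurman2026, Theorem A (i) and Remark 7.1] -/
theorem two_thirds_le_xiDerivCriticalLineProportion_two :
    (2 / 3 : ℝ) ≤ xiDerivCriticalLineProportion 2 := by
  refine le_of_forall_pos_lt_add fun ε hε ↦ ?_
  have h := le_xiDerivCriticalLineProportion_of_eventually_le 2
    (eventually_two_thirds_mul_xiDerivZeroCount_two_le (ε / 2) (by positivity))
  linarith

/-! ## §10. Consequences: `N^{(2)}/N → 1`, and every simple-critical proportion of `ζ` bounds `κ′₂` -/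

/-- **`N^{(2)}(T) ∼ N(T)`**: `N^{(2)}(T)/N(T) → 1`. [cite: Conrey1983, Lemma 2 (p. 52)] -/
theorem tendsto_xiDerivZeroCount_two_div_zetaZeroCount :
    Tendsto (fun T : ℝ ↦ (xiDerivZeroCount 2 T : ℝ) / zetaZeroCount T) atTop (𝓝 1) := by
  obtain ⟨C, T₀, hT₀, hC⟩ := exists_abs_xiDerivZeroCount_two_sub_zetaZeroCount_le_log
  have hmain := AlpogeFurman2026.eventually_zetaZeroCount_near_main (1 / 2) (by norm_num)
  have hlow : Tendsto (fun T : ℝ ↦ 1 - 4 * Real.pi * |C| * T⁻¹) atTop (𝓝 1) := by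
    have := (tendsto_inv_atTop_zero.const_mul (4 * Real.pi * |C|)).const_sub 1
    simpa using this
  have hhigh : Tendsto (fun T : ℝ ↦ 1 + 4 * Real.pi * |C| * T⁻¹) atTop (𝓝 1) := by
    have := (tendsto_inv_atTop_zero.const_mul (4 * Real.pi * |C|)).const_add 1
    simpa using this
  refine tendsto_of_tendsto_of_tendsto_of_le_of_le' hlow hhigh ?_ ?_
  all_goals
    filter_upwards [eventually_ge_atTop T₀, hmain, eventually_gt_atTop (1 : ℝ)] with T hT hN hT1
    have hπ := Real.pi_pos
    have hL : 0 < Real.log T := Real.log_pos hT1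
    have hM : 0 < T / (2 * Real.pi) * Real.log T := by positivity
    have hNpos : 0 < (zetaZeroCount T : ℝ) := by linarith [hN.1]
    have hb := hC T hT
    have hb' : |(xiDerivZeroCount 2 T : ℝ) - zetaZeroCount T| ≤ |C| * Real.log T :=
      hb.trans (mul_le_mul_of_nonneg_right (le_abs_self C) hL.le)
    have hq : |(xiDerivZeroCount 2 T : ℝ) / zetaZeroCount T - 1| ≤ 4 * Real.pi * |C| * T⁻¹ := by
      rw [show (xiDerivZeroCount 2 T : ℝ) / zetaZeroCount T - 1 =
        ((xiDerivZeroCount 2 T : ℝ) - zetaZeroCount T) / zetaZeroCount T by field_simp,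
        abs_div, abs_of_pos hNpos, div_le_iff₀ hNpos]
      have hN2 : (1 - 1 / 2) * (T / (2 * Real.pi) * Real.log T) ≤ zetaZeroCount T := hN.1
      calc |(xiDerivZeroCount 2 T : ℝ) - zetaZeroCount T| ≤ |C| * Real.log T := hb'
        _ = 4 * Real.pi * |C| * T⁻¹ * ((1 - 1 / 2) * (T / (2 * Real.pi) * Real.log T)) := by
          field_simp
          ring
        _ ≤ 4 * Real.pi * |C| * T⁻¹ * zetaZeroCount T :=
          mul_le_mul_of_nonneg_left hN2 (by positivity)
    have hq' := abs_le.1 hq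
  · linarith [hq'.1]
  · linarith [hq'.2]

/-- **From any cumulative simple-critical proportion of `ζ` to `ξ″`**: if for every `ε > 0`, eventually
`(κ − ε) N(T) ≤ N₀ˢ(T)`, then for every `ε > 0`, eventually `(κ − ε) N^{(2)}(T) ≤ N^{(2)}₀(T)`
(`N₀ˢ ≤ N^{(2)}₀ + 2` by two Rolle steps, `N^{(2)} = N + O(log T)` by Lemma 2).
[cite: Conrey1983, §1 (p. 49) and Lemma 2 (p. 52)] -/
theorem eventually_mul_xiDerivZeroCount_two_le_of_simpleCritical {κ : ℝ}
    (h : ∀ ε : ℝ, 0 < ε → ∀ᶠ T : ℝ in atTop, (κ - ε) * (zetaZeroCount T : ℝ) ≤ simpleCriticalZeroCount T)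
    (ε : ℝ) (hε : 0 < ε) :
    ∀ᶠ T : ℝ in atTop, (κ - ε) * (xiDerivZeroCount 2 T : ℝ) ≤ xiDerivCriticalZeroCount 2 T := by
  rcases le_or_gt (κ - ε) 0 with hneg | hpos
  · exact Filter.Eventually.of_forall fun T ↦ by
      have h0 : (0 : ℝ) ≤ xiDerivCriticalZeroCount 2 T := Nat.cast_nonneg _
      have h1 : (0 : ℝ) ≤ xiDerivZeroCount 2 T := Nat.cast_nonneg _
      nlinarith
  obtain ⟨C, T₀, hT₀, hC⟩ := exists_abs_xiDerivZeroCount_two_sub_zetaZeroCount_le_log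
  have hA := h (ε / 4) (by positivity)
  have hmain := AlpogeFurman2026.eventually_zetaZeroCount_near_main (1 / 2) (by norm_num)
  have hNlim : Tendsto (fun T : ℝ ↦ (zetaZeroCount T : ℝ)) atTop atTop :=
    tendsto_natCast_atTop_atTop.comp tendsto_zetaZeroCount_atTop_holds
  filter_upwards [hA, hmain, eventually_ge_atTop T₀, eventually_gt_atTop (1 : ℝ),
    eventually_ge_atTop (16 * Real.pi * |C| * κ / ε), hNlim.eventually_ge_atTop (8 / ε)]
    with T hAT hN hT hT1 hTC hNε
  have hπ := Real.pi_pos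
  have hL : 0 < Real.log T := Real.log_pos hT1
  have hκ : 0 < κ := by linarith
  have hR : (simpleCriticalZeroCount T : ℝ) ≤ (xiDerivCriticalZeroCount 2 T : ℝ) + 2 := by
    exact_mod_cast simpleCriticalZeroCount_le_xiDerivCriticalZeroCount_add 2 T
  have htwo : 2 ≤ ε / 4 * (zetaZeroCount T : ℝ) := by
    have := (div_le_iff₀ hε).1 hNε
    linarith
  have hb := hC T hT
  have hN₂le : (xiDerivZeroCount 2 T : ℝ) ≤ zetaZeroCount T + |C| * Real.log T := by
    have := (abs_le.1 (hb.trans (mul_le_mul_of_nonneg_right (le_abs_self C) hL.le))).2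
    linarith
  have hNlow : (1 - 1 / 2) * (T / (2 * Real.pi) * Real.log T) ≤ zetaZeroCount T := hN.1
  have hClog : κ * (|C| * Real.log T) ≤ ε / 4 * (zetaZeroCount T : ℝ) := by
    have h1 : κ * (|C| * Real.log T) ≤ ε / 4 * ((1 - 1 / 2) * (T / (2 * Real.pi) * Real.log T)) := by
      rw [div_le_iff₀ hε] at hTC
      have : κ * |C| ≤ ε / 4 * ((1 - 1 / 2) * (T / (2 * Real.pi))) := by
        rw [show ε / 4 * ((1 - 1 / 2) * (T / (2 * Real.pi))) = ε * T / (16 * Real.pi) by ring,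
          le_div_iff₀ (by positivity)]
        nlinarith
      nlinarith
    exact h1.trans (mul_le_mul_of_nonneg_left hNlow (by positivity))
  calc (κ - ε) * (xiDerivZeroCount 2 T : ℝ)
      ≤ (κ - ε) * (zetaZeroCount T + |C| * Real.log T) := mul_le_mul_of_nonneg_left hN₂le hpos.le
    _ ≤ (κ - ε) * zetaZeroCount T + κ * (|C| * Real.log T) := by
        nlinarith [mul_nonneg (abs_nonneg C) hL.le]
    _ ≤ (κ - ε / 4) * zetaZeroCount T - 2 := by nlinarith
    _ ≤ simpleCriticalZeroCount T - 2 := by linarith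
    _ ≤ xiDerivCriticalZeroCount 2 T := by linarith

/-- **Any cumulative proportion of simple critical zeros of `ζ` bounds `κ′₂` from below.**
[cite: Conrey1983, §1 (p. 49)] -/
theorem le_xiDerivCriticalLineProportion_two_of_simpleCritical {κ : ℝ}
    (h : ∀ ε : ℝ, 0 < ε → ∀ᶠ T : ℝ in atTop,
      (κ - ε) * (zetaZeroCount T : ℝ) ≤ simpleCriticalZeroCount T) :
    κ ≤ xiDerivCriticalLineProportion 2 := by
  refine le_of_forall_pos_lt_add fun ε hε ↦ ?_
  have h' := le_xiDerivCriticalLineProportion_of_eventually_le 2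
    (eventually_mul_xiDerivZeroCount_two_le_of_simpleCritical h (ε / 2) (by positivity))
  linarith

/-- **`κ′₂ ≥ 2 − c_MT⁻¹ = 0.67250…` unconditionally** (the Montgomery–Taylor simple-critical proportion of
[AF26] Theorem A, transferred to `ξ″`). [cite: AlpogeFurman2026, Theorem A (p. 1) and Remark 7.1]
[cite: Conrey1983, §1 (p. 49)] -/
theorem two_sub_montgomeryTaylorInvConstant_le_xiDerivCriticalLineProportion_two :
    2 - montgomeryTaylorInvConstant ≤ xiDerivCriticalLineProportion 2 :=
  le_xiDerivCriticalLineProportion_two_of_simpleCritical AlpogeFurman2026_simple_critical_MT_cumulative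

/-- Numerically: **`κ′₂ ≥ 0.6725`** — unconditionally, at least `67.25 %` of the zeros of `ξ″` (with
multiplicity, `liminf` sense) lie on the critical line. [cite: AlpogeFurman2026, Theorem A (p. 1) and Remark 7.1] -/
theorem xiDerivCriticalLineProportion_two_ge_06725 :
    (0.6725 : ℝ) ≤ xiDerivCriticalLineProportion 2 :=
  le_xiDerivCriticalLineProportion_two_of_simpleCritical AlpogeFurman2026_simple_critical_MT_cumulative'

end Literature.NumberTheory.LFunctions

end
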